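import Literature.Geometry.Riemannian.ChernFieldFour
import Literature.Geometry.Lorentzian.IndexFluxRemainder
import HarnessLib

/-!
# Chern's field near a nondegenerate zero: radial principal part and remainder

Pure analysis on `ℝ⁴`, the four-dimensional analogue of `Lorentzian/IndexFluxRemainder.lean` (the
planar normalized acceleration field) for the coordinate Chern field `chernCoordField G Z`
(`ChernFieldFour.lean`) of metric components `G` and a vector field `Z` with a NONDEGENERATE ZERO
at `c` (`Z c = 0`, `DZ(c) = L` invertible; `G_c(v, w) = ⟨Av, Aw⟩`). We PROVE
(`exists_chernCoordField_remainder_bound`) that on a punctured ball around `c` the field is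
continuous and

  `‖X(x) − (−2 det L/‖AL(x − c)‖⁴)(x − c)‖ ≤ C_R/‖x − c‖²`,

the hypothesis of the four-dimensional flux estimate
`IndexFlux.abs_integral_fderiv_cutoff_sub_le_four` (`IndexFluxLimitFour.lean`). The principal part is
the Chern field of the MODEL (constant metric `G_c`, linear field `L(x − c)`, flat): by
`chernSum₀_model` (`ChernVectorFrame.lean`) its `T₀`-sum is `6 ρ⁻⁴ det g det L (x − c)`, `ρ = ‖AL(x−c)‖`,
so the model field is `−2 det L (x − c)/ρ⁴` (Chern 1945, §2: the index of the zero as the limit of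
the flux of `Π` through small spheres). The remainder is controlled entrywise: with `r = ‖x − c‖`,
the lowered unit field satisfies `u♭ = u♭₀ + O(r)`, its lowered covariant differential
`N = N₀ + O(1)` with `N, N₀ = O(r⁻¹)`, the curvature array is `O(1)`, `(det g)⁻¹ = (det g₀)⁻¹ + O(r)`,
whence `T₀ = T₀⁰ + O(r⁻²)` (trilinear telescoping), `T₁ = O(r⁻¹)` and `X = X₀ + O(r⁻²)`.
Everything is proved; the auxiliary definitions are the explicit model quantities.

## References

* S.-S. Chern, *On the curvatura integra in a Riemannian manifold*, Ann. of Math. 46 (1945)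
  674–684, §2, (14)–(16). [Chern1945]
* J. Milnor, *Topology from the differentiable viewpoint* (1965), §6. [Milnor1965]
-/

noncomputable section

set_option maxSynthPendingDepth 3

open Set Filter Function Metric WithLp ContinuousLinearMap Matrix
open scoped Topology ContDiff RealInnerProductSpace

namespace Literature.Geometry.Riemannian

open Lorentzian Lorentzian.MetricCoord

/-- Local notation for the model spaces `ℝᵈ` with their Euclidean structure. -/
local notation "𝔼" n:max => EuclideanSpace ℝ (Fin n)

/-! ### The data at a nondegenerate zero and the primitive estimates -/

section ChernZeroData

variable {d : ℕ} (G : (𝔼 d) → (𝔼 d) →L[ℝ] (𝔼 d) →L[ℝ] ℝ) (V : Set (𝔼 d)) (c : 𝔼 d)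
  (A : (𝔼 d) ≃L[ℝ] (𝔼 d)) (Z : (𝔼 d) → (𝔼 d)) (L : (𝔼 d) ≃L[ℝ] (𝔼 d))

/-- **Primitive estimates at a nondegenerate zero**, valid on a ball `B(c, δ) ⊆ V`, `δ ≤ 1`:
Taylor (`Z = L(x − c) + O(r²)`, `DZ = L + O(r)`), Lipschitz continuity of the metric components,
boundedness of the Christoffel map and of `DG`, and the comparison of the squared length
`q = G(Z, Z)` with its model `ρ² = ‖AL(x − c)‖²` (`|q − ρ²| ≤ C_q r³`, `ρ² ≤ 2q ≤ 4ρ²`).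
A bookkeeping device for the remainder estimate. [folklore] -/
structure ChernZeroData : Type where
  /-- the radius -/
  δ : ℝ
  /-- Taylor constant of `Z` -/
  K₁ : ℝ
  /-- Lipschitz constant of `G` -/
  K₂ : ℝ
  /-- bound for the Christoffel map -/
  K₃ : ℝ
  /-- bound for `DG` -/
  K₄ : ℝ
  /-- constant of `|q − ρ²| ≤ C_q r³` -/
  Cq : ℝ
  δ_pos : 0 < δ
  δ_le_one : δ ≤ 1
  K₁_nonneg : 0 ≤ K₁
  K₂_nonneg : 0 ≤ K₂
  K₃_nonneg : 0 ≤ K₃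
  K₄_nonneg : 0 ≤ K₄
  Cq_nonneg : 0 ≤ Cq
  ball_subset : ball c δ ⊆ V
  taylor : ∀ x ∈ ball c δ, ‖fderiv ℝ Z x - (L : (𝔼 d) →L[ℝ] (𝔼 d))‖ ≤ K₁ * ‖x - c‖ ∧
    ‖Z x - L (x - c)‖ ≤ K₁ * ‖x - c‖ ^ 2
  metric_lip : ∀ x ∈ ball c δ, ‖G x - G c‖ ≤ K₂ * ‖x - c‖
  chrAt_le : ∀ x ∈ ball c δ, ‖chrAt G x‖ ≤ K₃
  fderiv_le : ∀ x ∈ ball c δ, ‖fderiv ℝ G x‖ ≤ K₄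
  sq_sub_le : ∀ x ∈ ball c δ \ {c}, |G x (Z x) (Z x) - ‖A (L (x - c))‖ ^ 2| ≤ Cq * ‖x - c‖ ^ 3
  sq_le_two_mul : ∀ x ∈ ball c δ \ {c}, ‖A (L (x - c))‖ ^ 2 ≤ 2 * G x (Z x) (Z x)
  le_two_mul_sq : ∀ x ∈ ball c δ \ {c}, G x (Z x) (Z x) ≤ 2 * ‖A (L (x - c))‖ ^ 2

variable {G V c A Z L}

/-- **`DG` is bounded near a point of `V`.** [folklore] -/
theorem _root_.Literature.Geometry.Lorentzian.MetricCoord.IsMetricOn.exists_fderiv_bound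
    (hG : IsMetricOn G V) (hc : c ∈ V) :
    ∃ K δ : ℝ, 0 ≤ K ∧ 0 < δ ∧ ∀ x ∈ ball c δ, ‖fderiv ℝ G x‖ ≤ K := by
  have hcont : Tendsto (fun x ↦ ‖fderiv ℝ G x‖) (𝓝 c) (𝓝 ‖fderiv ℝ G c‖) :=
    (continuous_norm.tendsto _).comp (hG.contDiffAt_fderiv hc).continuousAt.tendsto
  have hev : ∀ᶠ x in 𝓝 c, ‖fderiv ℝ G x‖ ≤ ‖fderiv ℝ G c‖ + 1 :=
    (hcont.eventually_lt_const (lt_add_one _)).mono fun x hx ↦ le_of_lt hx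
  obtain ⟨δ, hδ, hball⟩ := Metric.eventually_nhds_iff_ball.1 hev
  exact ⟨‖fderiv ℝ G c‖ + 1, δ, by positivity, hδ, fun x hx ↦ hball x hx⟩

set_option maxHeartbeats 400000 in
/-- **Existence of the primitive estimates** at a nondegenerate zero (Taylor, Lipschitz, bounds,
and `|q − ρ²| ≤ C_q r³` with `ρ² ≤ 2q ≤ 4ρ²`, exactly as in the planar
`IsMetricOn.exists_remainder_bound`). [folklore] -/
theorem exists_chernZeroData (hG : IsMetricOn G V) (hc : c ∈ V) (hA : ∀ v w, G c v w = ⟪A v, A w⟫)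
    (hZ : ContDiffOn ℝ ∞ Z V) (hZc : Z c = 0) (hL : fderiv ℝ Z c = L) :
    Nonempty (ChernZeroData G V c A Z L) := by
  obtain ⟨K₁, δ₁, hK₁, hδ₁, hV₁, hT⟩ := exists_taylor_bound hG.isOpen hc hZ
  obtain ⟨K₂, δ₂, hK₂, hδ₂, -, hGL⟩ := hG.exists_lipschitz_bound hc
  obtain ⟨K₃, δ₃, hK₃, hδ₃, hΓb⟩ := hG.exists_chrAt_bound hc
  obtain ⟨K₄, δ₄, hK₄, hδ₄, hDGb⟩ := hG.exists_fderiv_bound hc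
  set m : ℝ := ‖(L.symm : (𝔼 d) →L[ℝ] (𝔼 d))‖ with hm
  set a : ℝ := ‖(A.symm : (𝔼 d) →L[ℝ] (𝔼 d))‖ with ha
  set nL : ℝ := ‖(L : (𝔼 d) →L[ℝ] (𝔼 d))‖ with hnL
  set nG : ℝ := ‖G c‖ with hnG
  set Cq : ℝ := K₂ * (nL + 1) ^ 2 + nG * K₁ * (2 * nL + 1) with hCq
  have hCq0 : 0 ≤ Cq := by positivity
  set δ : ℝ := min δ₁ (min δ₂ (min δ₃ (min δ₄ (min 1 (min (1 / (K₁ + 1))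
    (1 / (2 * Cq * (m * a) ^ 2 + 1))))))) with hδdef
  have hδ : 0 < δ := by positivity
  have hδ₁' : δ ≤ δ₁ := min_le_left _ _
  have hδ₂' : δ ≤ δ₂ := le_trans (min_le_right _ _) (min_le_left _ _)
  have hδ₃' : δ ≤ δ₃ := le_trans (min_le_right _ _) (le_trans (min_le_right _ _) (min_le_left _ _))
  have hδ₄' : δ ≤ δ₄ := le_trans (min_le_right _ _) (le_trans (min_le_right _ _)
    (le_trans (min_le_right _ _) (min_le_left _ _)))
  have hδ1 : δ ≤ 1 := le_trans (min_le_right _ _) (le_trans (min_le_right _ _)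
    (le_trans (min_le_right _ _) (le_trans (min_le_right _ _) (min_le_left _ _))))
  have hδK : δ ≤ 1 / (K₁ + 1) := le_trans (min_le_right _ _) (le_trans (min_le_right _ _)
    (le_trans (min_le_right _ _) (le_trans (min_le_right _ _) (le_trans (min_le_right _ _)
    (min_le_left _ _)))))
  have hδC : δ ≤ 1 / (2 * Cq * (m * a) ^ 2 + 1) := le_trans (min_le_right _ _)
    (le_trans (min_le_right _ _) (le_trans (min_le_right _ _) (le_trans (min_le_right _ _)
    (le_trans (min_le_right _ _) (min_le_right _ _)))))
  have hδK' : K₁ * δ ≤ 1 := by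
    have h1 : K₁ / (K₁ + 1) ≤ 1 := by rw [div_le_one (by positivity)]; linarith
    calc K₁ * δ ≤ K₁ * (1 / (K₁ + 1)) := by gcongr
      _ = K₁ / (K₁ + 1) := mul_one_div _ _
      _ ≤ 1 := h1
  have hδC' : 2 * Cq * (m * a) ^ 2 * δ ≤ 1 := by
    have h1 : 2 * Cq * (m * a) ^ 2 / (2 * Cq * (m * a) ^ 2 + 1) ≤ 1 := by
      rw [div_le_one (by positivity)]; linarith
    calc 2 * Cq * (m * a) ^ 2 * δ ≤ 2 * Cq * (m * a) ^ 2 * (1 / (2 * Cq * (m * a) ^ 2 + 1)) := by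
          gcongr
      _ = 2 * Cq * (m * a) ^ 2 / (2 * Cq * (m * a) ^ 2 + 1) := mul_one_div _ _
      _ ≤ 1 := h1
  have hballV : ball c δ ⊆ V := (ball_subset_ball hδ₁').trans hV₁
  -- the comparison of `q` with `ρ²` on the punctured ball
  have key : ∀ x ∈ ball c δ \ {c},
      |G x (Z x) (Z x) - ‖A (L (x - c))‖ ^ 2| ≤ Cq * ‖x - c‖ ^ 3 ∧
      ‖A (L (x - c))‖ ^ 2 ≤ 2 * G x (Z x) (Z x) ∧ G x (Z x) (Z x) ≤ 2 * ‖A (L (x - c))‖ ^ 2 := by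
    intro x hx
    obtain ⟨hxb, hxc⟩ := hx
    have hxc' : x ≠ c := hxc
    set u : 𝔼 d := x - c with hu
    have hu0 : u ≠ 0 := sub_ne_zero.2 hxc'
    have huδ : ‖u‖ < δ := mem_ball_iff_norm.1 hxb
    have hu1 : ‖u‖ ≤ 1 := huδ.le.trans hδ1
    have hmL : ‖u‖ ≤ m * ‖L u‖ := by
      calc ‖u‖ = ‖(L.symm : (𝔼 d) →L[ℝ] (𝔼 d)) (L u)‖ := by simp
        _ ≤ m * ‖L u‖ := (L.symm : (𝔼 d) →L[ℝ] (𝔼 d)).le_opNorm _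
    have haA : ‖L u‖ ≤ a * ‖A (L u)‖ := by
      calc ‖L u‖ = ‖(A.symm : (𝔼 d) →L[ℝ] (𝔼 d)) (A (L u))‖ := by simp
        _ ≤ a * ‖A (L u)‖ := (A.symm : (𝔼 d) →L[ℝ] (𝔼 d)).le_opNorm _
    have hq₀pos : 0 < ‖A (L u)‖ ^ 2 := by
      have : A (L u) ≠ 0 := fun h0 ↦ hu0 (L.injective (A.injective (by rw [h0, map_zero, map_zero])))
      positivity
    have hu2 : ‖u‖ ^ 2 ≤ (m * a) ^ 2 * ‖A (L u)‖ ^ 2 := by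
      have hm0 : 0 ≤ m := norm_nonneg _
      have h1 : ‖u‖ ≤ m * a * ‖A (L u)‖ :=
        calc ‖u‖ ≤ m * ‖L u‖ := hmL
          _ ≤ m * (a * ‖A (L u)‖) := mul_le_mul_of_nonneg_left haA hm0
          _ = m * a * ‖A (L u)‖ := by ring
      calc ‖u‖ ^ 2 ≤ (m * a * ‖A (L u)‖) ^ 2 := pow_le_pow_left₀ (norm_nonneg u) h1 2
        _ = (m * a) ^ 2 * ‖A (L u)‖ ^ 2 := by ring
    obtain ⟨-, hZT⟩ := hT x (ball_subset_ball hδ₁' hxb)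
    rw [hZc, sub_zero, hL] at hZT
    have hLu : ‖L u‖ ≤ nL * ‖u‖ := (L : (𝔼 d) →L[ℝ] (𝔼 d)).le_opNorm u
    have hZ1 : ‖Z x - L u‖ ≤ K₁ * ‖u‖ ^ 2 := hZT
    have hZ1' : ‖Z x - L u‖ ≤ ‖u‖ := by
      calc ‖Z x - L u‖ ≤ K₁ * ‖u‖ ^ 2 := hZ1
        _ = (K₁ * ‖u‖) * ‖u‖ := by ring
        _ ≤ (K₁ * δ) * ‖u‖ := by gcongr
        _ ≤ 1 * ‖u‖ := by gcongr
        _ = ‖u‖ := one_mul _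
    have hZ2 : ‖Z x‖ ≤ (nL + 1) * ‖u‖ := by
      calc ‖Z x‖ = ‖L u + (Z x - L u)‖ := by abel_nf
        _ ≤ ‖L u‖ + ‖Z x - L u‖ := norm_add_le _ _
        _ ≤ nL * ‖u‖ + ‖u‖ := add_le_add hLu hZ1'
        _ = (nL + 1) * ‖u‖ := by ring
    have hGx : ‖G x - G c‖ ≤ K₂ * ‖u‖ := hGL x (ball_subset_ball hδ₂' hxb)
    have hq₀ : G c (L u) (L u) = ‖A (L u)‖ ^ 2 := by rw [hA, real_inner_self_eq_norm_sq]
    have hqd : |G x (Z x) (Z x) - ‖A (L u)‖ ^ 2| ≤ Cq * ‖u‖ ^ 3 := by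
      have e : G x (Z x) (Z x) - ‖A (L u)‖ ^ 2 =
          (G x - G c) (Z x) (Z x) + (G c (Z x - L u) (Z x) + G c (L u) (Z x - L u)) := by
        rw [← hq₀]
        simp only [_root_.sub_apply, map_sub]
        ring
      rw [e]
      have t1 : |(G x - G c) (Z x) (Z x)| ≤ K₂ * ‖u‖ * ((nL + 1) * ‖u‖) ^ 2 := by
        calc |(G x - G c) (Z x) (Z x)| ≤ ‖(G x - G c) (Z x)‖ * ‖Z x‖ :=
              (Real.norm_eq_abs _).symm.le.trans (((G x - G c) (Z x)).le_opNorm _)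
          _ ≤ (‖G x - G c‖ * ‖Z x‖) * ‖Z x‖ := by gcongr; exact (G x - G c).le_opNorm _
          _ ≤ (K₂ * ‖u‖ * ((nL + 1) * ‖u‖)) * ((nL + 1) * ‖u‖) := by gcongr
          _ = K₂ * ‖u‖ * ((nL + 1) * ‖u‖) ^ 2 := by ring
      have t2' : |G c (Z x - L u) (Z x)| ≤ nG * (K₁ * ‖u‖ ^ 2) * ((nL + 1) * ‖u‖) := by
        calc |G c (Z x - L u) (Z x)| ≤ ‖G c (Z x - L u)‖ * ‖Z x‖ :=
              (Real.norm_eq_abs _).symm.le.trans ((G c (Z x - L u)).le_opNorm _)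
          _ ≤ (‖G c‖ * ‖Z x - L u‖) * ‖Z x‖ := by gcongr; exact (G c).le_opNorm _
          _ ≤ (nG * (K₁ * ‖u‖ ^ 2)) * ((nL + 1) * ‖u‖) := by gcongr
      have t3' : |G c (L u) (Z x - L u)| ≤ nG * (nL * ‖u‖) * (K₁ * ‖u‖ ^ 2) := by
        calc |G c (L u) (Z x - L u)| ≤ ‖G c (L u)‖ * ‖Z x - L u‖ :=
              (Real.norm_eq_abs _).symm.le.trans ((G c (L u)).le_opNorm _)
          _ ≤ (‖G c‖ * ‖L u‖) * ‖Z x - L u‖ := by gcongr; exact (G c).le_opNorm _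
          _ ≤ (nG * (nL * ‖u‖)) * (K₁ * ‖u‖ ^ 2) := by gcongr
      calc |(G x - G c) (Z x) (Z x) + (G c (Z x - L u) (Z x) + G c (L u) (Z x - L u))|
          ≤ |(G x - G c) (Z x) (Z x)| + (|G c (Z x - L u) (Z x)| + |G c (L u) (Z x - L u)|) :=
            (abs_add_le _ _).trans (add_le_add le_rfl (abs_add_le _ _))
        _ ≤ K₂ * ‖u‖ * ((nL + 1) * ‖u‖) ^ 2 + (nG * (K₁ * ‖u‖ ^ 2) * ((nL + 1) * ‖u‖) +
            nG * (nL * ‖u‖) * (K₁ * ‖u‖ ^ 2)) := add_le_add t1 (add_le_add t2' t3')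
        _ = Cq * ‖u‖ ^ 3 := by rw [hCq]; ring
    have hsmall : Cq * ‖u‖ ^ 3 ≤ ‖A (L u)‖ ^ 2 / 2 := by
      calc Cq * ‖u‖ ^ 3 = (Cq * ‖u‖) * ‖u‖ ^ 2 := by ring
        _ ≤ (Cq * δ) * ((m * a) ^ 2 * ‖A (L u)‖ ^ 2) := by gcongr
        _ = (2 * Cq * (m * a) ^ 2 * δ) * ‖A (L u)‖ ^ 2 / 2 := by ring
        _ ≤ 1 * ‖A (L u)‖ ^ 2 / 2 := by gcongr
        _ = ‖A (L u)‖ ^ 2 / 2 := by ring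
    have h2 := (abs_sub_le_iff.1 hqd).2
    have h3 := (abs_sub_le_iff.1 hqd).1
    exact ⟨hqd, by linarith, by linarith⟩
  have htaylor : ∀ x ∈ ball c δ, ‖fderiv ℝ Z x - (L : (𝔼 d) →L[ℝ] (𝔼 d))‖ ≤ K₁ * ‖x - c‖ ∧
      ‖Z x - L (x - c)‖ ≤ K₁ * ‖x - c‖ ^ 2 := by
    intro x hx
    obtain ⟨h1, h2⟩ := hT x (ball_subset_ball hδ₁' hx)
    rw [hL] at h1
    rw [hZc, sub_zero, hL] at h2
    exact ⟨h1, h2⟩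
  exact ⟨{
    δ := δ
    K₁ := K₁
    K₂ := K₂
    K₃ := K₃
    K₄ := K₄
    Cq := Cq
    δ_pos := hδ
    δ_le_one := hδ1
    K₁_nonneg := hK₁
    K₂_nonneg := hK₂
    K₃_nonneg := hK₃
    K₄_nonneg := hK₄
    Cq_nonneg := hCq0
    ball_subset := hballV
    taylor := htaylor
    metric_lip := fun x hx ↦ hGL x (ball_subset_ball hδ₂' hx)
    chrAt_le := fun x hx ↦ hΓb x (ball_subset_ball hδ₃' hx)
    fderiv_le := fun x hx ↦ hDGb x (ball_subset_ball hδ₄' hx)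
    sq_sub_le := fun x hx ↦ (key x hx).1
    sq_le_two_mul := fun x hx ↦ (key x hx).2.1
    le_two_mul_sq := fun x hx ↦ (key x hx).2.2 }⟩

/-! ### Derived pointwise estimates on the punctured ball -/

namespace ChernZeroData

variable (𝓓 : ChernZeroData G V c A Z L)

/-- The constant `μ = ‖L⁻¹‖ ‖A⁻¹‖` (`r ≤ μ ρ`). [folklore] -/
def μ : ℝ := ‖(L.symm : (𝔼 d) →L[ℝ] (𝔼 d))‖ * ‖(A.symm : (𝔼 d) →L[ℝ] (𝔼 d))‖

/-- The constant `‖L‖`. [folklore] -/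
def nL : ℝ := ‖(L : (𝔼 d) →L[ℝ] (𝔼 d))‖

/-- The constant `‖G_c‖`. [folklore] -/
def nG : ℝ := ‖G c‖

omit 𝓓 in
/-- `μ ≥ 0`. [folklore] -/
theorem μ_nonneg : 0 ≤ μ (A := A) (L := L) := by unfold μ; positivity

omit 𝓓 in
/-- `‖L‖ ≥ 0`. [folklore] -/
theorem nL_nonneg : 0 ≤ nL (d := d) (L := L) := norm_nonneg _

omit 𝓓 in
/-- `‖G_c‖ ≥ 0`. [folklore] -/
theorem nG_nonneg : 0 ≤ nG (G := G) (c := c) := norm_nonneg _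

variable {𝓓} {x : 𝔼 d}

/-- Points of the punctured ball: `0 < r = ‖x − c‖ < δ ≤ 1`. [folklore] -/
theorem norm_pos (hx : x ∈ ball c 𝓓.δ \ {c}) : 0 < ‖x - c‖ :=
  norm_pos_iff.2 (sub_ne_zero.2 hx.2)

/-- Points of the punctured ball: `r ≤ 1`. [folklore] -/
theorem norm_le_one (hx : x ∈ ball c 𝓓.δ \ {c}) : ‖x - c‖ ≤ 1 :=
  (mem_ball_iff_norm.1 hx.1).le.trans 𝓓.δ_le_one

/-- Points of the punctured ball: `r < δ`. [folklore] -/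
theorem norm_lt_δ (hx : x ∈ ball c 𝓓.δ \ {c}) : ‖x - c‖ < 𝓓.δ := mem_ball_iff_norm.1 hx.1

/-- Points of the ball lie in `V`. [folklore] -/
theorem mem_V (hx : x ∈ ball c 𝓓.δ \ {c}) : x ∈ V := 𝓓.ball_subset hx.1

/-- **`r ≤ μ ρ`**: `‖x − c‖ ≤ ‖L⁻¹‖ ‖A⁻¹‖ ‖AL(x − c)‖`. [folklore] -/
theorem norm_le_μ_mul (y : 𝔼 d) : ‖y‖ ≤ μ (A := A) (L := L) * ‖A (L y)‖ := by
  unfold μ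
  calc ‖y‖ = ‖(L.symm : (𝔼 d) →L[ℝ] (𝔼 d)) ((A.symm : (𝔼 d) →L[ℝ] (𝔼 d)) (A (L y)))‖ := by simp
    _ ≤ ‖(L.symm : (𝔼 d) →L[ℝ] (𝔼 d))‖ * ‖(A.symm : (𝔼 d) →L[ℝ] (𝔼 d)) (A (L y))‖ :=
        (L.symm : (𝔼 d) →L[ℝ] (𝔼 d)).le_opNorm _
    _ ≤ ‖(L.symm : (𝔼 d) →L[ℝ] (𝔼 d))‖ * (‖(A.symm : (𝔼 d) →L[ℝ] (𝔼 d))‖ * ‖A (L y)‖) := by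
        gcongr; exact (A.symm : (𝔼 d) →L[ℝ] (𝔼 d)).le_opNorm _
    _ = _ := by ring

/-- **`ρ > 0`** on the punctured ball. [folklore] -/
theorem rho_pos (hx : x ∈ ball c 𝓓.δ \ {c}) : 0 < ‖A (L (x - c))‖ := by
  have h := norm_le_μ_mul (A := A) (L := L) (x - c)
  have hr := norm_pos hx
  have hμ := μ_nonneg (A := A) (L := L)
  by_contra h0
  have h0' : ‖A (L (x - c))‖ = 0 := le_antisymm (not_lt.1 h0) (norm_nonneg _)
  rw [h0', mul_zero] at h
  linarith

/-- **`ρ⁻¹ ≤ μ/r`.** [folklore] -/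
theorem inv_rho_le (hx : x ∈ ball c 𝓓.δ \ {c}) :
    ‖A (L (x - c))‖⁻¹ ≤ μ (A := A) (L := L) / ‖x - c‖ := by
  rw [inv_eq_one_div, div_le_div_iff₀ (rho_pos hx) (norm_pos hx), one_mul]
  exact norm_le_μ_mul (x - c)

/-- `‖L y‖ ≤ ‖L‖ r`. [folklore] -/
theorem norm_L_le (y : 𝔼 d) : ‖L y‖ ≤ nL (L := L) * ‖y‖ := (L : (𝔼 d) →L[ℝ] (𝔼 d)).le_opNorm y

/-- **`‖Z x‖ ≤ (‖L‖ + 1) r`** (since `K₁ δ ≤ 1` is not assumed, through `K₁ r² ≤ K₁ r`: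
we use the cruder `‖Z x‖ ≤ (‖L‖ + K₁) r`). [folklore] -/
theorem norm_Z_le (hx : x ∈ ball c 𝓓.δ \ {c}) : ‖Z x‖ ≤ (nL (L := L) + 𝓓.K₁) * ‖x - c‖ := by
  have h := (𝓓.taylor x hx.1).2
  have h1 := norm_le_one hx
  have hK := 𝓓.K₁_nonneg
  calc ‖Z x‖ = ‖L (x - c) + (Z x - L (x - c))‖ := by abel_nf
    _ ≤ ‖L (x - c)‖ + ‖Z x - L (x - c)‖ := norm_add_le _ _
    _ ≤ nL (L := L) * ‖x - c‖ + 𝓓.K₁ * ‖x - c‖ ^ 2 := add_le_add (norm_L_le _) h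
    _ ≤ nL (L := L) * ‖x - c‖ + 𝓓.K₁ * ‖x - c‖ := by
        gcongr
        calc ‖x - c‖ ^ 2 = ‖x - c‖ * ‖x - c‖ := sq _
          _ ≤ ‖x - c‖ * 1 := by gcongr
          _ = ‖x - c‖ := mul_one _
    _ = _ := by ring

/-- `‖DZ(x)‖ ≤ ‖L‖ + K₁`. [folklore] -/
theorem norm_fderiv_Z_le (hx : x ∈ ball c 𝓓.δ \ {c}) :
    ‖fderiv ℝ Z x‖ ≤ nL (L := L) + 𝓓.K₁ := by
  have h := (𝓓.taylor x hx.1).1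
  have h1 := norm_le_one hx
  have hK := 𝓓.K₁_nonneg
  calc ‖fderiv ℝ Z x‖ = ‖(L : (𝔼 d) →L[ℝ] (𝔼 d)) + (fderiv ℝ Z x - (L : (𝔼 d) →L[ℝ] (𝔼 d)))‖ := by
        abel_nf
    _ ≤ nL (L := L) + 𝓓.K₁ * ‖x - c‖ := (norm_add_le _ _).trans (add_le_add le_rfl h)
    _ ≤ nL (L := L) + 𝓓.K₁ * 1 := by gcongr
    _ = _ := by ring

/-- `‖G x‖ ≤ ‖G c‖ + K₂`. [folklore] -/
theorem norm_G_le (hx : x ∈ ball c 𝓓.δ \ {c}) : ‖G x‖ ≤ nG (G := G) (c := c) + 𝓓.K₂ := by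
  have h := 𝓓.metric_lip x hx.1
  have h1 := norm_le_one hx
  have hK := 𝓓.K₂_nonneg
  calc ‖G x‖ = ‖G c + (G x - G c)‖ := by abel_nf
    _ ≤ nG (G := G) (c := c) + 𝓓.K₂ * ‖x - c‖ := (norm_add_le _ _).trans (add_le_add le_rfl h)
    _ ≤ nG (G := G) (c := c) + 𝓓.K₂ * 1 := by gcongr
    _ = _ := by ring

/-! #### The length `s = √q` against `ρ` -/

/-- `0 < q = G(Z,Z)` on the punctured ball. [folklore] -/
theorem q_pos (hx : x ∈ ball c 𝓓.δ \ {c}) : 0 < G x (Z x) (Z x) := by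
  have h := 𝓓.sq_le_two_mul x hx
  have hρ := rho_pos hx
  nlinarith

/-- `0 < s = √q`. [folklore] -/
theorem sqrt_pos (hx : x ∈ ball c 𝓓.δ \ {c}) : 0 < Real.sqrt (G x (Z x) (Z x)) :=
  Real.sqrt_pos.2 (q_pos hx)

/-- **`ρ ≤ 2 s`** (from `ρ² ≤ 2q ≤ 4 s²`). [folklore] -/
theorem rho_le_two_mul_sqrt (hx : x ∈ ball c 𝓓.δ \ {c}) :
    ‖A (L (x - c))‖ ≤ 2 * Real.sqrt (G x (Z x) (Z x)) := by
  have h := 𝓓.sq_le_two_mul x hx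
  have hs := Real.sq_sqrt (q_pos hx).le
  have hρ := (rho_pos hx).le
  have hs0 := (sqrt_pos hx).le
  nlinarith

/-- **`s ≤ 2 ρ`** (from `q ≤ 2ρ²`). [folklore] -/
theorem sqrt_le_two_mul_rho (hx : x ∈ ball c 𝓓.δ \ {c}) :
    Real.sqrt (G x (Z x) (Z x)) ≤ 2 * ‖A (L (x - c))‖ := by
  have h := 𝓓.le_two_mul_sq x hx
  have hs := Real.sq_sqrt (q_pos hx).le
  have hρ := (rho_pos hx).le
  have hs0 := (sqrt_pos hx).le
  nlinarith

/-- **`s⁻¹ ≤ 2μ/r`.** [folklore] -/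
theorem inv_sqrt_le (hx : x ∈ ball c 𝓓.δ \ {c}) :
    (Real.sqrt (G x (Z x) (Z x)))⁻¹ ≤ 2 * μ (A := A) (L := L) / ‖x - c‖ := by
  have h1 : (Real.sqrt (G x (Z x) (Z x)))⁻¹ ≤ 2 * ‖A (L (x - c))‖⁻¹ := by
    rw [inv_eq_one_div, ← div_eq_mul_inv, div_le_div_iff₀ (sqrt_pos hx) (rho_pos hx), one_mul]
    exact rho_le_two_mul_sqrt hx
  have h2 := inv_rho_le hx
  calc _ ≤ 2 * ‖A (L (x - c))‖⁻¹ := h1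
    _ ≤ 2 * (μ (A := A) (L := L) / ‖x - c‖) := by gcongr
    _ = _ := by ring

/-- **`|s − ρ| ≤ C_q r³/ρ`.** [folklore] -/
theorem abs_sqrt_sub_rho_le (hx : x ∈ ball c 𝓓.δ \ {c}) :
    |Real.sqrt (G x (Z x) (Z x)) - ‖A (L (x - c))‖| ≤ 𝓓.Cq * ‖x - c‖ ^ 3 / ‖A (L (x - c))‖ := by
  set s := Real.sqrt (G x (Z x) (Z x)) with hs
  set ρ := ‖A (L (x - c))‖ with hρ
  have hρ0 : 0 < ρ := rho_pos hx
  have hs0 : 0 < s := sqrt_pos hx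
  have hsq : s ^ 2 = G x (Z x) (Z x) := Real.sq_sqrt (q_pos hx).le
  have h := 𝓓.sq_sub_le x hx
  rw [← hsq] at h
  have hsρ : s + ρ ≠ 0 := by positivity
  have hfac : s - ρ = (s ^ 2 - ρ ^ 2) / (s + ρ) := by
    rw [eq_div_iff hsρ]
    ring
  rw [hfac, abs_div, abs_of_pos (by positivity : 0 < s + ρ)]
  calc |s ^ 2 - ρ ^ 2| / (s + ρ) ≤ 𝓓.Cq * ‖x - c‖ ^ 3 / (s + ρ) := by gcongr
    _ ≤ 𝓓.Cq * ‖x - c‖ ^ 3 / ρ := by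
        have := 𝓓.Cq_nonneg
        gcongr
        linarith

/-- **`|s⁻¹ − ρ⁻¹| ≤ 2 C_q μ³`** (bounded). [folklore] -/
theorem abs_inv_sqrt_sub_inv_rho_le (hx : x ∈ ball c 𝓓.δ \ {c}) :
    |(Real.sqrt (G x (Z x) (Z x)))⁻¹ - ‖A (L (x - c))‖⁻¹| ≤ 2 * 𝓓.Cq * μ (A := A) (L := L) ^ 3 := by
  set s := Real.sqrt (G x (Z x) (Z x)) with hs
  set ρ := ‖A (L (x - c))‖ with hρ
  set r := ‖x - c‖ with hr
  have hρ0 : 0 < ρ := rho_pos hx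
  have hs0 : 0 < s := sqrt_pos hx
  have hr0 : 0 < r := norm_pos hx
  have h1 : |s - ρ| ≤ 𝓓.Cq * r ^ 3 / ρ := abs_sqrt_sub_rho_le hx
  have h2 : ρ ≤ 2 * s := rho_le_two_mul_sqrt hx
  have hrμ : r ≤ μ (A := A) (L := L) * ρ := norm_le_μ_mul (x - c)
  have hCq := 𝓓.Cq_nonneg
  have hμ := μ_nonneg (A := A) (L := L)
  have hdiff : s⁻¹ - ρ⁻¹ = (ρ - s) / (s * ρ) := by field_simp
  rw [hdiff, abs_div, abs_of_pos (by positivity : 0 < s * ρ), abs_sub_comm]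
  rw [div_le_iff₀ (by positivity : 0 < s * ρ)]
  calc |s - ρ| ≤ 𝓓.Cq * r ^ 3 / ρ := h1
    _ ≤ 𝓓.Cq * (μ (A := A) (L := L) * ρ) ^ 3 / ρ := by gcongr
    _ = 𝓓.Cq * μ (A := A) (L := L) ^ 3 * ρ * ρ := by rw [div_eq_iff hρ0.ne']; ring
    _ ≤ 𝓓.Cq * μ (A := A) (L := L) ^ 3 * (2 * s) * ρ := by gcongr
    _ = 2 * 𝓓.Cq * μ (A := A) (L := L) ^ 3 * (s * ρ) := by ring

/-- **`|s⁻³ − ρ⁻³| ≤ 14 C_q μ⁵/r²`.** [folklore] -/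
theorem abs_inv_sqrt_cube_sub_le (hx : x ∈ ball c 𝓓.δ \ {c}) :
    |(Real.sqrt (G x (Z x) (Z x)))⁻¹ ^ 3 - ‖A (L (x - c))‖⁻¹ ^ 3| ≤
      14 * 𝓓.Cq * μ (A := A) (L := L) ^ 5 / ‖x - c‖ ^ 2 := by
  set s := Real.sqrt (G x (Z x) (Z x)) with hs
  set ρ := ‖A (L (x - c))‖ with hρ
  set r := ‖x - c‖ with hr
  have hρ0 : 0 < ρ := rho_pos hx
  have hs0 : 0 < s := sqrt_pos hx
  have hr0 : 0 < r := norm_pos hx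
  have hCq := 𝓓.Cq_nonneg
  have hμ := μ_nonneg (A := A) (L := L)
  have h1 : |s⁻¹ - ρ⁻¹| ≤ 2 * 𝓓.Cq * μ (A := A) (L := L) ^ 3 := abs_inv_sqrt_sub_inv_rho_le hx
  have h2 : ρ ≤ 2 * s := rho_le_two_mul_sqrt hx
  have hρi : ρ⁻¹ ≤ μ (A := A) (L := L) / r := inv_rho_le hx
  have hsi : s⁻¹ ≤ 2 * ρ⁻¹ := by
    rw [inv_eq_one_div, ← div_eq_mul_inv, div_le_div_iff₀ hs0 hρ0, one_mul]; exact h2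
  have hfac : s⁻¹ ^ 3 - ρ⁻¹ ^ 3 = (s⁻¹ - ρ⁻¹) * (s⁻¹ ^ 2 + s⁻¹ * ρ⁻¹ + ρ⁻¹ ^ 2) := by ring
  rw [hfac, abs_mul]
  have hsum : |s⁻¹ ^ 2 + s⁻¹ * ρ⁻¹ + ρ⁻¹ ^ 2| ≤ 7 * ρ⁻¹ ^ 2 := by
    rw [abs_of_nonneg (by positivity)]
    nlinarith [inv_pos.2 hs0, inv_pos.2 hρ0]
  calc |s⁻¹ - ρ⁻¹| * |s⁻¹ ^ 2 + s⁻¹ * ρ⁻¹ + ρ⁻¹ ^ 2|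
      ≤ (2 * 𝓓.Cq * μ (A := A) (L := L) ^ 3) * (7 * ρ⁻¹ ^ 2) := by gcongr
    _ ≤ (2 * 𝓓.Cq * μ (A := A) (L := L) ^ 3) * (7 * (μ (A := A) (L := L) / r) ^ 2) := by gcongr
    _ = 14 * 𝓓.Cq * μ (A := A) (L := L) ^ 5 / r ^ 2 := by field_simp; ring

/-! #### The unit field and its differential against the model -/

/-- **`‖û‖ ≤ 2μ(‖L‖ + K₁)`**: the unit field `û = Z/√q` is bounded. [folklore] -/
theorem norm_unit_le (hx : x ∈ ball c 𝓓.δ \ {c}) :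
    ‖metricUnitField G Z x‖ ≤ 2 * μ (A := A) (L := L) * (nL (L := L) + 𝓓.K₁) := by
  have hr := norm_pos hx
  have hμ := μ_nonneg (A := A) (L := L)
  rw [unitVec_apply, norm_smul, Real.norm_eq_abs, abs_of_pos (inv_pos.2 (sqrt_pos hx))]
  calc (Real.sqrt (G x (Z x) (Z x)))⁻¹ * ‖Z x‖
      ≤ (2 * μ (A := A) (L := L) / ‖x - c‖) * ((nL (L := L) + 𝓓.K₁) * ‖x - c‖) := by
        have := 𝓓.K₁_nonneg; have := nL_nonneg (d := d) (L := L)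
        exact mul_le_mul (inv_sqrt_le hx) (norm_Z_le hx) (norm_nonneg _) (by positivity)
    _ = 2 * μ (A := A) (L := L) * (nL (L := L) + 𝓓.K₁) := by field_simp

/-- **`û = ρ⁻¹ L(x − c) + O(r)`**: `‖û − ρ⁻¹ L(x − c)‖ ≤ (2μK₁ + 2C_qμ³‖L‖) r`. [folklore] -/
theorem norm_unit_sub_le (hx : x ∈ ball c 𝓓.δ \ {c}) :
    ‖metricUnitField G Z x - ‖A (L (x - c))‖⁻¹ • L (x - c)‖ ≤
      (2 * μ (A := A) (L := L) * 𝓓.K₁ + 2 * 𝓓.Cq * μ (A := A) (L := L) ^ 3 * nL (L := L)) * ‖x - c‖ := by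
  set s := Real.sqrt (G x (Z x) (Z x)) with hs
  set ρ := ‖A (L (x - c))‖ with hρ
  set r := ‖x - c‖ with hr
  have hr0 : 0 < r := norm_pos hx
  have hμ := μ_nonneg (A := A) (L := L)
  have hK := 𝓓.K₁_nonneg
  have hdec : metricUnitField G Z x - ρ⁻¹ • L (x - c) =
      s⁻¹ • (Z x - L (x - c)) + (s⁻¹ - ρ⁻¹) • L (x - c) := by
    rw [unitVec_apply, smul_sub, sub_smul]; abel
  rw [hdec]
  have h1 : ‖s⁻¹ • (Z x - L (x - c))‖ ≤ 2 * μ (A := A) (L := L) * 𝓓.K₁ * r := by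
    rw [norm_smul, Real.norm_eq_abs, abs_of_pos (inv_pos.2 (sqrt_pos hx))]
    calc s⁻¹ * ‖Z x - L (x - c)‖ ≤ (2 * μ (A := A) (L := L) / r) * (𝓓.K₁ * r ^ 2) :=
          mul_le_mul (inv_sqrt_le hx) (𝓓.taylor x hx.1).2 (norm_nonneg _) (by positivity)
      _ = 2 * μ (A := A) (L := L) * 𝓓.K₁ * r := by field_simp
  have h2 : ‖(s⁻¹ - ρ⁻¹) • L (x - c)‖ ≤ 2 * 𝓓.Cq * μ (A := A) (L := L) ^ 3 * nL (L := L) * r := by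
    rw [norm_smul, Real.norm_eq_abs]
    calc |s⁻¹ - ρ⁻¹| * ‖L (x - c)‖ ≤ (2 * 𝓓.Cq * μ (A := A) (L := L) ^ 3) * (nL (L := L) * r) :=
          mul_le_mul (abs_inv_sqrt_sub_inv_rho_le hx) (norm_L_le _) (norm_nonneg _)
            (by have := 𝓓.Cq_nonneg; positivity)
      _ = _ := by ring
  calc _ ≤ ‖s⁻¹ • (Z x - L (x - c))‖ + ‖(s⁻¹ - ρ⁻¹) • L (x - c)‖ := norm_add_le _ _
    _ ≤ _ := add_le_add h1 h2
    _ = _ := by ring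

/-- The constant `C₁ = K₁ + K₃(‖L‖ + K₁)` of `‖∇Z − L‖ ≤ C₁ r`. [folklore] -/
def C₁ : ℝ := 𝓓.K₁ + 𝓓.K₃ * (nL (L := L) + 𝓓.K₁)

/-- `C₁ ≥ 0`. [folklore] -/
theorem C₁_nonneg : 0 ≤ 𝓓.C₁ := by
  have := 𝓓.K₁_nonneg; have := 𝓓.K₃_nonneg; have := nL_nonneg (d := d) (L := L)
  unfold C₁; positivity

/-- **`∇Z = L + O(r)`**: `‖covDAt G Z x − L‖ ≤ C₁ r`. [folklore] -/
theorem norm_covDAt_sub_le (hx : x ∈ ball c 𝓓.δ \ {c}) :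
    ‖covDAt G Z x - (L : (𝔼 d) →L[ℝ] (𝔼 d))‖ ≤ 𝓓.C₁ * ‖x - c‖ := by
  have h1 := (𝓓.taylor x hx.1).1
  have h2 : ‖chrAt G x (Z x)‖ ≤ 𝓓.K₃ * ((nL (L := L) + 𝓓.K₁) * ‖x - c‖) :=
    ((chrAt G x).le_opNorm _).trans (mul_le_mul (𝓓.chrAt_le x hx.1) (norm_Z_le hx)
      (norm_nonneg _) 𝓓.K₃_nonneg)
  have hdec : covDAt G Z x - (L : (𝔼 d) →L[ℝ] (𝔼 d)) =
      (fderiv ℝ Z x - (L : (𝔼 d) →L[ℝ] (𝔼 d))) + chrAt G x (Z x) := by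
    rw [covDAt]; abel
  rw [hdec]
  calc _ ≤ ‖fderiv ℝ Z x - (L : (𝔼 d) →L[ℝ] (𝔼 d))‖ + ‖chrAt G x (Z x)‖ := norm_add_le _ _
    _ ≤ 𝓓.K₁ * ‖x - c‖ + 𝓓.K₃ * ((nL (L := L) + 𝓓.K₁) * ‖x - c‖) := add_le_add h1 h2
    _ = 𝓓.C₁ * ‖x - c‖ := by unfold C₁; ring

/-- `‖∇Z‖ ≤ ‖L‖ + C₁`. [folklore] -/
theorem norm_covDAt_le (hx : x ∈ ball c 𝓓.δ \ {c}) :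
    ‖covDAt G Z x‖ ≤ nL (L := L) + 𝓓.C₁ := by
  have h := norm_covDAt_sub_le hx
  have h1 := norm_le_one hx
  have hC := 𝓓.C₁_nonneg
  calc ‖covDAt G Z x‖ = ‖(L : (𝔼 d) →L[ℝ] (𝔼 d)) + (covDAt G Z x - (L : (𝔼 d) →L[ℝ] (𝔼 d)))‖ := by
        abel_nf
    _ ≤ nL (L := L) + 𝓓.C₁ * ‖x - c‖ := (norm_add_le _ _).trans (add_le_add le_rfl h)
    _ ≤ nL (L := L) + 𝓓.C₁ * 1 := by gcongr
    _ = _ := by ring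

end ChernZeroData

/-! #### The derivative of `q = G(Z,Z)` and of the unit field -/

/-- **The derivative of the squared length** `q = G(Z, Z)` (`∂_v q = 2 G(∇_v Z, Z)`,
`IsMetricOn.hasFDerivAt_apply_self`), as a covector. [cite: ONeill1983, Ch. 3, Prop. 3.13] -/
def sqDeriv (G : (𝔼 d) → (𝔼 d) →L[ℝ] (𝔼 d) →L[ℝ] ℝ) (Z : (𝔼 d) → (𝔼 d)) (x : 𝔼 d) :
    (𝔼 d) →L[ℝ] ℝ :=
  (2 : ℝ) • ((G x).flip (Z x)).comp (covDAt G Z x)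

/-- The derivative of the squared length of the MODEL (constant metric `G_c`, linear field):
`∂_v q₀ = 2 G_c(L v, L(x − c))`. [folklore] -/
def modelSqDeriv (G : (𝔼 d) → (𝔼 d) →L[ℝ] (𝔼 d) →L[ℝ] ℝ) (c : 𝔼 d) (L : (𝔼 d) ≃L[ℝ] (𝔼 d))
    (x : 𝔼 d) : (𝔼 d) →L[ℝ] ℝ :=
  (2 : ℝ) • ((G c).flip (L (x - c))).comp (L : (𝔼 d) →L[ℝ] (𝔼 d))

/-- **The differential of the unit field** `û = q^{-1/2} Z`:
`Dû = s⁻¹ DZ + (−s⁻²·(2s)⁻¹ Dq) ⊗ Z`, `s = √q`. [folklore] -/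
def unitDeriv (G : (𝔼 d) → (𝔼 d) →L[ℝ] (𝔼 d) →L[ℝ] ℝ) (Z : (𝔼 d) → (𝔼 d)) (x : 𝔼 d) :
    (𝔼 d) →L[ℝ] (𝔼 d) :=
  (Real.sqrt (G x (Z x) (Z x)))⁻¹ • fderiv ℝ Z x +
    ((-(Real.sqrt (G x (Z x) (Z x)) ^ 2)⁻¹) • ((1 / (2 * Real.sqrt (G x (Z x) (Z x)))) •
      sqDeriv G Z x)).smulRight (Z x)

/-- The differential of the MODEL unit field `û₀ = ρ⁻¹ L(x − c)`:
`Dû₀ = ρ⁻¹ L + (−ρ⁻²·(2ρ)⁻¹ Dq₀) ⊗ L(x − c)`, `ρ = ‖AL(x − c)‖`. [folklore] -/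
def modelUnitDeriv (G : (𝔼 d) → (𝔼 d) →L[ℝ] (𝔼 d) →L[ℝ] ℝ) (c : 𝔼 d) (A L : (𝔼 d) ≃L[ℝ] (𝔼 d))
    (x : 𝔼 d) : (𝔼 d) →L[ℝ] (𝔼 d) :=
  ‖A (L (x - c))‖⁻¹ • (L : (𝔼 d) →L[ℝ] (𝔼 d)) +
    ((-(‖A (L (x - c))‖ ^ 2)⁻¹) • ((1 / (2 * ‖A (L (x - c))‖)) • modelSqDeriv G c L x)).smulRight
      (L (x - c))

namespace ChernZeroData

variable {𝓓 : ChernZeroData G V c A Z L} {x : 𝔼 d}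

/-- `Z` is differentiable at the points of the ball (smooth on the open `V`). [folklore] -/
theorem differentiableAt_Z (hG : IsMetricOn G V) (hZ : ContDiffOn ℝ ∞ Z V) (hx : x ∈ ball c 𝓓.δ \ {c}) :
    DifferentiableAt ℝ Z x :=
  ((hZ x (mem_V hx)).contDiffAt (hG.mem_nhds (mem_V hx))).differentiableAt (by simp)

/-- **The unit field has differential `unitDeriv`** on the punctured ball. [folklore] -/
theorem hasFDerivAt_unit (hG : IsMetricOn G V) (hZ : ContDiffOn ℝ ∞ Z V) (hx : x ∈ ball c 𝓓.δ \ {c}) :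
    HasFDerivAt (metricUnitField G Z) (unitDeriv G Z x) x := by
  have hZd := differentiableAt_Z hG hZ hx
  have hq : HasFDerivAt (fun y ↦ G y (Z y) (Z y)) (sqDeriv G Z x) x :=
    hG.hasFDerivAt_apply_self (mem_V hx) hZd
  have hsqrt := hq.sqrt (q_pos hx).ne'
  have hinv := (hasDerivAt_inv (sqrt_pos hx).ne').comp_hasFDerivAt x hsqrt
  have h := hinv.smul hZd.hasFDerivAt
  exact h

/-- **`Dq = Dq₀ + O(r²)`**: `‖sqDeriv − modelSqDeriv‖ ≤ C_dq r²` with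
`C_dq = 2(K₂(‖L‖+C₁)(‖L‖+K₁) + ‖G_c‖ C₁ (‖L‖+K₁) + ‖G_c‖‖L‖K₁)`. [folklore] -/
def Cdq : ℝ := 2 * (𝓓.K₂ * (nL (L := L) + 𝓓.C₁) * (nL (L := L) + 𝓓.K₁) +
  nG (G := G) (c := c) * 𝓓.C₁ * (nL (L := L) + 𝓓.K₁) + nG (G := G) (c := c) * nL (L := L) * 𝓓.K₁)

/-- `C_dq ≥ 0`. [folklore] -/
theorem Cdq_nonneg : 0 ≤ 𝓓.Cdq := by
  have := 𝓓.K₁_nonneg; have := 𝓓.K₂_nonneg; have := 𝓓.C₁_nonneg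
  have := nL_nonneg (d := d) (L := L); have := nG_nonneg (G := G) (c := c)
  unfold Cdq; positivity

/-- **`‖Dq − Dq₀‖ ≤ C_dq r²`.** [folklore] -/
theorem norm_sqDeriv_sub_le (hx : x ∈ ball c 𝓓.δ \ {c}) :
    ‖sqDeriv G Z x - modelSqDeriv G c L x‖ ≤ 𝓓.Cdq * ‖x - c‖ ^ 2 := by
  set r := ‖x - c‖ with hr
  have hr0 : 0 < r := norm_pos hx
  have hr1 : r ≤ 1 := norm_le_one hx
  have hK₁ := 𝓓.K₁_nonneg; have hK₂ := 𝓓.K₂_nonneg; have hC₁ := 𝓓.C₁_nonneg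
  have hnL := nL_nonneg (d := d) (L := L); have hnG := nG_nonneg (G := G) (c := c)
  have hZ := norm_Z_le hx
  have hcov := norm_covDAt_le hx
  have hcovs := norm_covDAt_sub_le hx
  have hZs := (𝓓.taylor x hx.1).2
  have hGx := 𝓓.metric_lip x hx.1
  -- decomposition of the difference of the two covector-valued products
  have hdec : sqDeriv G Z x - modelSqDeriv G c L x =
      (2 : ℝ) • ((((G x - G c).flip (Z x)).comp (covDAt G Z x)) +
        (((G c).flip (Z x - L (x - c))).comp (covDAt G Z x)) +
        (((G c).flip (L (x - c))).comp (covDAt G Z x - (L : (𝔼 d) →L[ℝ] (𝔼 d))))) := by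
    simp only [sqDeriv, modelSqDeriv, ← smul_sub]
    congr 1
    ext v
    simp only [_root_.sub_apply, ContinuousLinearMap.comp_apply, flip_apply,
      _root_.add_apply, map_sub]
    ring
  rw [hdec, norm_smul, Real.norm_two]
  have t1 : ‖((G x - G c).flip (Z x)).comp (covDAt G Z x)‖ ≤
      (𝓓.K₂ * r) * ((nL (L := L) + 𝓓.K₁) * r) * (nL (L := L) + 𝓓.C₁) := by
    calc _ ≤ ‖(G x - G c).flip (Z x)‖ * ‖covDAt G Z x‖ := opNorm_comp_le _ _
      _ ≤ (‖(G x - G c).flip‖ * ‖Z x‖) * ‖covDAt G Z x‖ := by gcongr; exact le_opNorm _ _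
      _ = (‖G x - G c‖ * ‖Z x‖) * ‖covDAt G Z x‖ := by rw [opNorm_flip]
      _ ≤ (𝓓.K₂ * r * ((nL (L := L) + 𝓓.K₁) * r)) * (nL (L := L) + 𝓓.C₁) := by gcongr
  have t2 : ‖((G c).flip (Z x - L (x - c))).comp (covDAt G Z x)‖ ≤
      (nG (G := G) (c := c) * (𝓓.K₁ * r ^ 2)) * (nL (L := L) + 𝓓.C₁) := by
    calc _ ≤ ‖(G c).flip (Z x - L (x - c))‖ * ‖covDAt G Z x‖ := opNorm_comp_le _ _
      _ ≤ (‖(G c).flip‖ * ‖Z x - L (x - c)‖) * ‖covDAt G Z x‖ := by gcongr; exact le_opNorm _ _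
      _ = (nG (G := G) (c := c) * ‖Z x - L (x - c)‖) * ‖covDAt G Z x‖ := by rw [opNorm_flip]; rfl
      _ ≤ (nG (G := G) (c := c) * (𝓓.K₁ * r ^ 2)) * (nL (L := L) + 𝓓.C₁) := by gcongr
  have t3 : ‖((G c).flip (L (x - c))).comp (covDAt G Z x - (L : (𝔼 d) →L[ℝ] (𝔼 d)))‖ ≤
      (nG (G := G) (c := c) * (nL (L := L) * r)) * (𝓓.C₁ * r) := by
    calc _ ≤ ‖(G c).flip (L (x - c))‖ * ‖covDAt G Z x - (L : (𝔼 d) →L[ℝ] (𝔼 d))‖ :=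
          opNorm_comp_le _ _
      _ ≤ (‖(G c).flip‖ * ‖L (x - c)‖) * ‖covDAt G Z x - (L : (𝔼 d) →L[ℝ] (𝔼 d))‖ := by
          gcongr; exact le_opNorm _ _
      _ = (nG (G := G) (c := c) * ‖L (x - c)‖) * ‖covDAt G Z x - (L : (𝔼 d) →L[ℝ] (𝔼 d))‖ := by
          rw [opNorm_flip]; rfl
      _ ≤ (nG (G := G) (c := c) * (nL (L := L) * r)) * (𝓓.C₁ * r) := by
          gcongr; exact norm_L_le _
  calc 2 * ‖(((G x - G c).flip (Z x)).comp (covDAt G Z x)) +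
        (((G c).flip (Z x - L (x - c))).comp (covDAt G Z x)) +
        (((G c).flip (L (x - c))).comp (covDAt G Z x - (L : (𝔼 d) →L[ℝ] (𝔼 d))))‖
      ≤ 2 * ((𝓓.K₂ * r) * ((nL (L := L) + 𝓓.K₁) * r) * (nL (L := L) + 𝓓.C₁) +
          (nG (G := G) (c := c) * (𝓓.K₁ * r ^ 2)) * (nL (L := L) + 𝓓.C₁) +
          (nG (G := G) (c := c) * (nL (L := L) * r)) * (𝓓.C₁ * r)) := by
        gcongr
        exact (norm_add_le _ _).trans (add_le_add ((norm_add_le _ _).trans (add_le_add t1 t2)) t3)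
    _ = 𝓓.Cdq * r ^ 2 := by unfold Cdq; ring

/-- **`‖Dq₀‖ ≤ 2‖G_c‖‖L‖² r`.** [folklore] -/
theorem norm_modelSqDeriv_le (x : 𝔼 d) :
    ‖modelSqDeriv G c L x‖ ≤ 2 * nG (G := G) (c := c) * nL (L := L) ^ 2 * ‖x - c‖ := by
  have hnL := nL_nonneg (d := d) (L := L); have hnG := nG_nonneg (G := G) (c := c)
  rw [modelSqDeriv, norm_smul, Real.norm_two]
  calc 2 * ‖((G c).flip (L (x - c))).comp (L : (𝔼 d) →L[ℝ] (𝔼 d))‖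
      ≤ 2 * (‖(G c).flip (L (x - c))‖ * nL (L := L)) := by gcongr; exact opNorm_comp_le _ _
    _ ≤ 2 * ((‖(G c).flip‖ * ‖L (x - c)‖) * nL (L := L)) := by gcongr; exact le_opNorm _ _
    _ = 2 * ((nG (G := G) (c := c) * ‖L (x - c)‖) * nL (L := L)) := by rw [opNorm_flip]; rfl
    _ ≤ 2 * ((nG (G := G) (c := c) * (nL (L := L) * ‖x - c‖)) * nL (L := L)) := by
        gcongr; exact norm_L_le _
    _ = _ := by ring

/-- The constant `C_du` of `‖Dû − Dû₀‖ ≤ C_du`. [folklore] -/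
def Cdu : ℝ := 2 * μ (A := A) (L := L) * 𝓓.K₁ + 2 * 𝓓.Cq * μ (A := A) (L := L) ^ 3 * nL (L := L) +
  (4 * μ (A := A) (L := L) ^ 3 * 𝓓.Cdq +
    14 * 𝓓.Cq * μ (A := A) (L := L) ^ 5 * nG (G := G) (c := c) * nL (L := L) ^ 2) *
      (nL (L := L) + 𝓓.K₁) +
  μ (A := A) (L := L) ^ 3 * nG (G := G) (c := c) * nL (L := L) ^ 2 * 𝓓.K₁

/-- `C_du ≥ 0`. [folklore] -/
theorem Cdu_nonneg : 0 ≤ 𝓓.Cdu := by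
  have := 𝓓.K₁_nonneg; have := 𝓓.Cq_nonneg; have := 𝓓.Cdq_nonneg
  have := nL_nonneg (d := d) (L := L); have := nG_nonneg (G := G) (c := c)
  have := μ_nonneg (A := A) (L := L)
  unfold Cdu; positivity

/-- **`Dû = Dû₀ + O(1)`**: `‖unitDeriv − modelUnitDeriv‖ ≤ C_du` on the punctured ball. [folklore] -/
theorem norm_unitDeriv_sub_le (hx : x ∈ ball c 𝓓.δ \ {c}) :
    ‖unitDeriv G Z x - modelUnitDeriv G c A L x‖ ≤ 𝓓.Cdu := by
  set s := Real.sqrt (G x (Z x) (Z x)) with hs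
  set ρ := ‖A (L (x - c))‖ with hρ
  set r := ‖x - c‖ with hr
  have hρ0 : 0 < ρ := rho_pos hx
  have hs0 : 0 < s := sqrt_pos hx
  have hr0 : 0 < r := norm_pos hx
  have hr1 : r ≤ 1 := norm_le_one hx
  have hK₁ := 𝓓.K₁_nonneg; have hCq := 𝓓.Cq_nonneg; have hCdq := 𝓓.Cdq_nonneg
  have hnL := nL_nonneg (d := d) (L := L); have hnG := nG_nonneg (G := G) (c := c)
  have hμ := μ_nonneg (A := A) (L := L)
  set Dq := sqDeriv G Z x with hDq
  set Dq₀ := modelSqDeriv G c L x with hDq₀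
  set a : ℝ := -(s ^ 2)⁻¹ * (1 / (2 * s)) with ha
  set a₀ : ℝ := -(ρ ^ 2)⁻¹ * (1 / (2 * ρ)) with ha₀
  have ha' : a = -(1 / 2) * s⁻¹ ^ 3 := by rw [ha]; field_simp
  have ha₀' : a₀ = -(1 / 2) * ρ⁻¹ ^ 3 := by rw [ha₀]; field_simp
  -- the decomposition
  have hdec : unitDeriv G Z x - modelUnitDeriv G c A L x =
      (s⁻¹ • (fderiv ℝ Z x - (L : (𝔼 d) →L[ℝ] (𝔼 d))) + (s⁻¹ - ρ⁻¹) • (L : (𝔼 d) →L[ℝ] (𝔼 d))) +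
      ((a • (Dq - Dq₀) + (a - a₀) • Dq₀).smulRight (Z x) +
        (a₀ • Dq₀).smulRight (Z x - L (x - c))) := by
    simp only [unitDeriv, modelUnitDeriv, smul_smul, ← hDq, ← hDq₀]
    ext v : 1
    simp only [_root_.sub_apply, _root_.add_apply, FunLike.coe_smul, Pi.smul_apply,
      ContinuousLinearMap.smulRight_apply, ContinuousLinearEquiv.coe_coe, smul_eq_mul]
    module
  rw [hdec]
  -- the scalar bounds
  have hs_inv : s⁻¹ ≤ 2 * μ (A := A) (L := L) / r := inv_sqrt_le hx
  have habs_a : |a| ≤ 4 * μ (A := A) (L := L) ^ 3 / r ^ 3 := by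
    rw [ha', abs_mul, abs_neg, abs_of_pos (by norm_num : (0 : ℝ) < 1 / 2),
      abs_of_nonneg (by positivity)]
    calc 1 / 2 * s⁻¹ ^ 3 ≤ 1 / 2 * (2 * μ (A := A) (L := L) / r) ^ 3 := by gcongr
      _ = _ := by field_simp; ring
  have habs_a₀ : |a₀| ≤ 1 / 2 * (μ (A := A) (L := L) / r) ^ 3 := by
    rw [ha₀', abs_mul, abs_neg, abs_of_pos (by norm_num : (0 : ℝ) < 1 / 2),
      abs_of_nonneg (by positivity)]
    gcongr
    exact inv_rho_le hx
  have habs_aa₀ : |a - a₀| ≤ 7 * 𝓓.Cq * μ (A := A) (L := L) ^ 5 / r ^ 2 := by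
    have h := abs_inv_sqrt_cube_sub_le hx
    rw [ha', ha₀', ← mul_sub, abs_mul, abs_neg, abs_of_pos (by norm_num : (0 : ℝ) < 1 / 2)]
    calc 1 / 2 * |s⁻¹ ^ 3 - ρ⁻¹ ^ 3| ≤ 1 / 2 * (14 * 𝓓.Cq * μ (A := A) (L := L) ^ 5 / r ^ 2) := by
          gcongr
      _ = _ := by ring
  have hDqs : ‖Dq - Dq₀‖ ≤ 𝓓.Cdq * r ^ 2 := norm_sqDeriv_sub_le hx
  have hDq₀ : ‖Dq₀‖ ≤ 2 * nG (G := G) (c := c) * nL (L := L) ^ 2 * r := norm_modelSqDeriv_le x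
  have hZ : ‖Z x‖ ≤ (nL (L := L) + 𝓓.K₁) * r := norm_Z_le hx
  have hZs : ‖Z x - L (x - c)‖ ≤ 𝓓.K₁ * r ^ 2 := (𝓓.taylor x hx.1).2
  -- term 1
  have t1 : ‖s⁻¹ • (fderiv ℝ Z x - (L : (𝔼 d) →L[ℝ] (𝔼 d))) +
      (s⁻¹ - ρ⁻¹) • (L : (𝔼 d) →L[ℝ] (𝔼 d))‖ ≤
      2 * μ (A := A) (L := L) * 𝓓.K₁ + 2 * 𝓓.Cq * μ (A := A) (L := L) ^ 3 * nL (L := L) := by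
    have h1 : ‖s⁻¹ • (fderiv ℝ Z x - (L : (𝔼 d) →L[ℝ] (𝔼 d)))‖ ≤ 2 * μ (A := A) (L := L) * 𝓓.K₁ := by
      rw [norm_smul, Real.norm_eq_abs, abs_of_pos (inv_pos.2 hs0)]
      calc s⁻¹ * ‖fderiv ℝ Z x - (L : (𝔼 d) →L[ℝ] (𝔼 d))‖
          ≤ (2 * μ (A := A) (L := L) / r) * (𝓓.K₁ * r) :=
            mul_le_mul hs_inv (𝓓.taylor x hx.1).1 (norm_nonneg _) (by positivity)
        _ = _ := by field_simp
    have h2 : ‖(s⁻¹ - ρ⁻¹) • (L : (𝔼 d) →L[ℝ] (𝔼 d))‖ ≤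
        2 * 𝓓.Cq * μ (A := A) (L := L) ^ 3 * nL (L := L) := by
      rw [norm_smul, Real.norm_eq_abs]
      exact mul_le_mul (abs_inv_sqrt_sub_inv_rho_le hx) le_rfl (norm_nonneg _) (by positivity)
    exact (norm_add_le _ _).trans (add_le_add h1 h2)
  -- term 2
  have t2 : ‖(a • (Dq - Dq₀) + (a - a₀) • Dq₀).smulRight (Z x)‖ ≤
      (4 * μ (A := A) (L := L) ^ 3 * 𝓓.Cdq +
        14 * 𝓓.Cq * μ (A := A) (L := L) ^ 5 * nG (G := G) (c := c) * nL (L := L) ^ 2) *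
        (nL (L := L) + 𝓓.K₁) := by
    rw [norm_smulRight_apply]
    have h1 : ‖a • (Dq - Dq₀)‖ ≤ 4 * μ (A := A) (L := L) ^ 3 * 𝓓.Cdq / r := by
      rw [norm_smul, Real.norm_eq_abs]
      calc |a| * ‖Dq - Dq₀‖ ≤ (4 * μ (A := A) (L := L) ^ 3 / r ^ 3) * (𝓓.Cdq * r ^ 2) :=
            mul_le_mul habs_a hDqs (norm_nonneg _) (by positivity)
        _ = _ := by field_simp
    have h2 : ‖(a - a₀) • Dq₀‖ ≤
        14 * 𝓓.Cq * μ (A := A) (L := L) ^ 5 * nG (G := G) (c := c) * nL (L := L) ^ 2 / r := by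
      rw [norm_smul, Real.norm_eq_abs]
      calc |a - a₀| * ‖Dq₀‖ ≤ (7 * 𝓓.Cq * μ (A := A) (L := L) ^ 5 / r ^ 2) *
            (2 * nG (G := G) (c := c) * nL (L := L) ^ 2 * r) :=
            mul_le_mul habs_aa₀ hDq₀ (norm_nonneg _) (by positivity)
        _ = _ := by field_simp; ring
    calc ‖a • (Dq - Dq₀) + (a - a₀) • Dq₀‖ * ‖Z x‖
        ≤ (4 * μ (A := A) (L := L) ^ 3 * 𝓓.Cdq / r +
            14 * 𝓓.Cq * μ (A := A) (L := L) ^ 5 * nG (G := G) (c := c) * nL (L := L) ^ 2 / r) *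
          ((nL (L := L) + 𝓓.K₁) * r) :=
          mul_le_mul ((norm_add_le _ _).trans (add_le_add h1 h2)) hZ (norm_nonneg _)
            (by positivity)
      _ = _ := by field_simp
  -- term 3
  have t3 : ‖(a₀ • Dq₀).smulRight (Z x - L (x - c))‖ ≤
      μ (A := A) (L := L) ^ 3 * nG (G := G) (c := c) * nL (L := L) ^ 2 * 𝓓.K₁ := by
    rw [norm_smulRight_apply, norm_smul, Real.norm_eq_abs]
    calc |a₀| * ‖Dq₀‖ * ‖Z x - L (x - c)‖
        ≤ (1 / 2 * (μ (A := A) (L := L) / r) ^ 3) * (2 * nG (G := G) (c := c) * nL (L := L) ^ 2 * r) *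
          (𝓓.K₁ * r ^ 2) := by gcongr
      _ = _ := by field_simp
  calc _ ≤ ‖s⁻¹ • (fderiv ℝ Z x - (L : (𝔼 d) →L[ℝ] (𝔼 d))) +
        (s⁻¹ - ρ⁻¹) • (L : (𝔼 d) →L[ℝ] (𝔼 d))‖ +
      (‖(a • (Dq - Dq₀) + (a - a₀) • Dq₀).smulRight (Z x)‖ +
        ‖(a₀ • Dq₀).smulRight (Z x - L (x - c))‖) :=
        (norm_add_le _ _).trans (add_le_add le_rfl (norm_add_le _ _))
    _ ≤ _ := add_le_add t1 (add_le_add t2 t3)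
    _ = 𝓓.Cdu := by unfold Cdu; ring

/-- The constant `M₀ = μ‖L‖ + μ³‖G_c‖‖L‖³` of `‖Dû₀‖ ≤ M₀/r`. [folklore] -/
def M₀ : ℝ := μ (A := A) (L := L) * nL (L := L) +
  μ (A := A) (L := L) ^ 3 * nG (G := G) (c := c) * nL (L := L) ^ 3

/-- `M₀ ≥ 0`. [folklore] -/
theorem M₀_nonneg : 0 ≤ M₀ (G := G) (c := c) (A := A) (L := L) := by
  have := nL_nonneg (d := d) (L := L); have := nG_nonneg (G := G) (c := c)
  have := μ_nonneg (A := A) (L := L)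
  unfold M₀; positivity

/-- **`‖Dû₀‖ ≤ M₀/r`.** [folklore] -/
theorem norm_modelUnitDeriv_le (hx : x ∈ ball c 𝓓.δ \ {c}) :
    ‖modelUnitDeriv G c A L x‖ ≤ M₀ (G := G) (c := c) (A := A) (L := L) / ‖x - c‖ := by
  set ρ := ‖A (L (x - c))‖ with hρ
  set r := ‖x - c‖ with hr
  have hρ0 : 0 < ρ := rho_pos hx
  have hr0 : 0 < r := norm_pos hx
  have hnL := nL_nonneg (d := d) (L := L); have hnG := nG_nonneg (G := G) (c := c)
  have hμ := μ_nonneg (A := A) (L := L)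
  have hρi : ρ⁻¹ ≤ μ (A := A) (L := L) / r := inv_rho_le hx
  have hDq₀ : ‖modelSqDeriv G c L x‖ ≤ 2 * nG (G := G) (c := c) * nL (L := L) ^ 2 * r :=
    norm_modelSqDeriv_le x
  have h1 : ‖ρ⁻¹ • (L : (𝔼 d) →L[ℝ] (𝔼 d))‖ ≤ μ (A := A) (L := L) / r * nL (L := L) := by
    rw [norm_smul, Real.norm_eq_abs, abs_of_pos (inv_pos.2 hρ0)]
    exact mul_le_mul hρi le_rfl (norm_nonneg _) (by positivity)
  have h2 : ‖((-(ρ ^ 2)⁻¹) • ((1 / (2 * ρ)) • modelSqDeriv G c L x)).smulRight (L (x - c))‖ ≤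
      μ (A := A) (L := L) ^ 3 * nG (G := G) (c := c) * nL (L := L) ^ 3 / r := by
    rw [norm_smulRight_apply, smul_smul, norm_smul, Real.norm_eq_abs]
    have hsc : |-(ρ ^ 2)⁻¹ * (1 / (2 * ρ))| ≤ 1 / 2 * (μ (A := A) (L := L) / r) ^ 3 := by
      have : -(ρ ^ 2)⁻¹ * (1 / (2 * ρ)) = -(1 / 2) * ρ⁻¹ ^ 3 := by field_simp
      rw [this, abs_mul, abs_neg, abs_of_pos (by norm_num : (0 : ℝ) < 1 / 2),
        abs_of_nonneg (by positivity)]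
      gcongr
    calc |-(ρ ^ 2)⁻¹ * (1 / (2 * ρ))| * ‖modelSqDeriv G c L x‖ * ‖L (x - c)‖
        ≤ (1 / 2 * (μ (A := A) (L := L) / r) ^ 3) * (2 * nG (G := G) (c := c) * nL (L := L) ^ 2 * r) *
          (nL (L := L) * r) := by gcongr; exact norm_L_le _
      _ = _ := by field_simp
  calc ‖modelUnitDeriv G c A L x‖ ≤ ‖ρ⁻¹ • (L : (𝔼 d) →L[ℝ] (𝔼 d))‖ +
      ‖((-(ρ ^ 2)⁻¹) • ((1 / (2 * ρ)) • modelSqDeriv G c L x)).smulRight (L (x - c))‖ :=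
        norm_add_le _ _
    _ ≤ μ (A := A) (L := L) / r * nL (L := L) +
        μ (A := A) (L := L) ^ 3 * nG (G := G) (c := c) * nL (L := L) ^ 3 / r := add_le_add h1 h2
    _ = _ := by unfold M₀; field_simp

end ChernZeroData

end ChernZeroData

/-! ### The coordinate arrays of the field and of the model (dimension four) -/

section Entries

variable (G : (𝔼 4) → (𝔼 4) →L[ℝ] (𝔼 4) →L[ℝ] ℝ) (c : 𝔼 4) (A : (𝔼 4) ≃L[ℝ] (𝔼 4))
  (Z : (𝔼 4) → (𝔼 4)) (L : (𝔼 4) ≃L[ℝ] (𝔼 4))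

/-- The Gram matrix `g_{ij}(x) = G_x(eᵢ, eⱼ)` in the standard basis. [folklore] -/
def gramStd (x : 𝔼 4) : Matrix (Fin 4) (Fin 4) ℝ := frameGram (G x).toLinearMap₁₂ (coordBasis 4)

/-- The lowered unit field `u♭_a = G_x(û, e_a)`. [folklore] -/
def lowUnit (x : 𝔼 4) : Fin 4 → ℝ :=
  frameCovector (G x).toLinearMap₁₂ (metricUnitField G Z x) (coordBasis 4)

/-- The lowered covariant differential of the unit field `N_{ak} = G_x(∇_{e_k} û, e_a)`. [folklore] -/
def lowEndo (x : 𝔼 4) : Matrix (Fin 4) (Fin 4) ℝ :=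
  frameEndo (G x).toLinearMap₁₂
    ((covDAt G (metricUnitField G Z) x : (𝔼 4) →L[ℝ] (𝔼 4)) : (𝔼 4) →ₗ[ℝ] (𝔼 4)) (coordBasis 4)

/-- The curvature array `W_{ackl} = G_x(R(e_k, e_l)e_c, e_a)`. [folklore] -/
def curvArray (x : 𝔼 4) : Fin 4 → Fin 4 → Fin 4 → Fin 4 → ℝ :=
  frameCurv (G x).toLinearMap₁₂ (riemAtₗ G x) (coordBasis 4)

/-- The MODEL unit field `û₀ = L(x − c)/‖AL(x − c)‖`. [folklore] -/
def modelUnit (x : 𝔼 4) : 𝔼 4 := ‖A (L (x - c))‖⁻¹ • L (x - c)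

/-- The lowered model unit field `u♭⁰_a = G_c(û₀, e_a)`. [folklore] -/
def modelLowUnit (x : 𝔼 4) : Fin 4 → ℝ :=
  frameCovector (G c).toLinearMap₁₂ (modelUnit c A L x) (coordBasis 4)

/-- The lowered differential of the model unit field `N⁰_{ak} = G_c(Dû₀ e_k, e_a)`. [folklore] -/
def modelLowEndo (x : 𝔼 4) : Matrix (Fin 4) (Fin 4) ℝ :=
  frameEndo (G c).toLinearMap₁₂
    ((modelUnitDeriv G c A L x : (𝔼 4) →L[ℝ] (𝔼 4)) : (𝔼 4) →ₗ[ℝ] (𝔼 4)) (coordBasis 4)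

variable {G c A Z L}

/-- **The coordinate Chern field in terms of the arrays**:
`Xᵢ = chernVec g u♭ W N i`. [cite: Chern1945, (9)] -/
theorem chernCoordField_eq_chernVec (x : 𝔼 4) (i : Fin 4) :
    chernCoordField G Z x i = chernVec (gramStd G x) (lowUnit G Z x) (curvArray G x) (lowEndo G Z x) i := by
  rw [chernCoordField_def, chernVecOfFrame_def, sum_smul_coordBasis_apply]
  rfl

/-- `‖eₐ‖ = 1`. [folklore] -/
theorem norm_coordBasis (a : Fin 4) : ‖(coordBasis 4 a : 𝔼 4)‖ = 1 := by
  rw [coordBasis, OrthonormalBasis.coe_toBasis]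
  exact (EuclideanSpace.basisFun (Fin 4) ℝ).orthonormal.1 a

/-- `|B(v, eₐ)| ≤ ‖B‖ ‖v‖`. [folklore] -/
theorem abs_apply_coordBasis_le (B : (𝔼 4) →L[ℝ] (𝔼 4) →L[ℝ] ℝ) (v : 𝔼 4) (a : Fin 4) :
    |B v (coordBasis 4 a)| ≤ ‖B‖ * ‖v‖ := by
  have h := B.le_opNorm₂ v (coordBasis 4 a)
  rwa [norm_coordBasis, mul_one, Real.norm_eq_abs] at h

/-- `‖T eₖ‖ ≤ ‖T‖`. [folklore] -/
theorem norm_apply_coordBasis_le (T : (𝔼 4) →L[ℝ] (𝔼 4)) (k : Fin 4) :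
    ‖T (coordBasis 4 k)‖ ≤ ‖T‖ := by
  have h := T.le_opNorm (coordBasis 4 k)
  rwa [norm_coordBasis, mul_one] at h

namespace ChernZeroData

variable {V : Set (𝔼 4)} {𝓓 : ChernZeroData G V c A Z L} {x : 𝔼 4}

/-- The constant `C_u` of `|u♭ − u♭⁰| ≤ C_u r`. [folklore] -/
def Cu : ℝ := 𝓓.K₂ * (2 * μ (A := A) (L := L) * (nL (L := L) + 𝓓.K₁)) +
  nG (G := G) (c := c) * (2 * μ (A := A) (L := L) * 𝓓.K₁ + 2 * 𝓓.Cq * μ (A := A) (L := L) ^ 3 * nL (L := L))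

/-- `C_u ≥ 0`. [folklore] -/
theorem Cu_nonneg : 0 ≤ 𝓓.Cu := by
  have := 𝓓.K₁_nonneg; have := 𝓓.K₂_nonneg; have := 𝓓.Cq_nonneg
  have := nL_nonneg (d := 4) (L := L); have := nG_nonneg (G := G) (c := c)
  have := μ_nonneg (A := A) (L := L)
  unfold Cu; positivity

/-- **`u♭ = u♭⁰ + O(r)`**: `|u♭_a − u♭⁰_a| ≤ C_u r`. [folklore] -/
theorem abs_lowUnit_sub_le (hx : x ∈ ball c 𝓓.δ \ {c}) (a : Fin 4) :
    |lowUnit G Z x a - modelLowUnit G c A L x a| ≤ 𝓓.Cu * ‖x - c‖ := by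
  have hK₂ := 𝓓.K₂_nonneg; have hnG := nG_nonneg (G := G) (c := c)
  have hu := norm_unit_le hx
  have hus := norm_unit_sub_le hx
  have hGl := 𝓓.metric_lip x hx.1
  have hdec : lowUnit G Z x a - modelLowUnit G c A L x a =
      (G x - G c) (metricUnitField G Z x) (coordBasis 4 a) +
        G c (metricUnitField G Z x - modelUnit c A L x) (coordBasis 4 a) := by
    simp only [lowUnit, modelLowUnit, modelUnit, frameCovector_apply,
      ContinuousLinearMap.toLinearMap₁₂_apply, _root_.sub_apply, map_sub]
    ring
  rw [hdec]
  have h1 : |(G x - G c) (metricUnitField G Z x) (coordBasis 4 a)| ≤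
      (𝓓.K₂ * ‖x - c‖) * (2 * μ (A := A) (L := L) * (nL (L := L) + 𝓓.K₁)) :=
    (abs_apply_coordBasis_le _ _ _).trans (mul_le_mul hGl hu (norm_nonneg _) (by positivity))
  have h2 : |G c (metricUnitField G Z x - modelUnit c A L x) (coordBasis 4 a)| ≤
      nG (G := G) (c := c) * ((2 * μ (A := A) (L := L) * 𝓓.K₁ +
        2 * 𝓓.Cq * μ (A := A) (L := L) ^ 3 * nL (L := L)) * ‖x - c‖) :=
    (abs_apply_coordBasis_le _ _ _).trans (mul_le_mul le_rfl hus (norm_nonneg _) hnG)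
  calc _ ≤ _ := abs_add_le _ _
    _ ≤ _ := add_le_add h1 h2
    _ = 𝓓.Cu * ‖x - c‖ := by unfold Cu; ring

/-- `‖û₀‖ ≤ μ‖L‖`. [folklore] -/
theorem norm_modelUnit_le (hx : x ∈ ball c 𝓓.δ \ {c}) :
    ‖modelUnit c A L x‖ ≤ μ (A := A) (L := L) * nL (L := L) := by
  have hr := norm_pos hx
  have hμ := μ_nonneg (A := A) (L := L); have hnL := nL_nonneg (d := 4) (L := L)
  rw [modelUnit, norm_smul, Real.norm_eq_abs, abs_of_pos (inv_pos.2 (rho_pos hx))]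
  calc ‖A (L (x - c))‖⁻¹ * ‖L (x - c)‖ ≤ (μ (A := A) (L := L) / ‖x - c‖) * (nL (L := L) * ‖x - c‖) :=
        mul_le_mul (inv_rho_le hx) (norm_L_le _) (norm_nonneg _) (by positivity)
    _ = _ := by field_simp

/-- The common bound `B_u = ‖G_c‖μ‖L‖ + 2(‖G_c‖ + K₂)μ(‖L‖ + K₁)` for `|u♭|` and `|u♭⁰|`.
[folklore] -/
def Bu : ℝ := nG (G := G) (c := c) * μ (A := A) (L := L) * nL (L := L) +
  2 * (nG (G := G) (c := c) + 𝓓.K₂) * μ (A := A) (L := L) * (nL (L := L) + 𝓓.K₁)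

/-- `B_u ≥ 0`. [folklore] -/
theorem Bu_nonneg : 0 ≤ 𝓓.Bu := by
  have := 𝓓.K₁_nonneg; have := 𝓓.K₂_nonneg
  have := nL_nonneg (d := 4) (L := L); have := nG_nonneg (G := G) (c := c)
  have := μ_nonneg (A := A) (L := L)
  unfold Bu; positivity

/-- **`|u♭⁰_a| ≤ B_u`.** [folklore] -/
theorem abs_modelLowUnit_le (hx : x ∈ ball c 𝓓.δ \ {c}) (a : Fin 4) :
    |modelLowUnit G c A L x a| ≤ 𝓓.Bu := by
  have := 𝓓.K₁_nonneg; have := 𝓓.K₂_nonneg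
  have hnL := nL_nonneg (d := 4) (L := L); have hnG := nG_nonneg (G := G) (c := c)
  have hμ := μ_nonneg (A := A) (L := L)
  have h : |modelLowUnit G c A L x a| ≤ nG (G := G) (c := c) * (μ (A := A) (L := L) * nL (L := L)) := by
    simp only [modelLowUnit, frameCovector_apply, ContinuousLinearMap.toLinearMap₁₂_apply]
    exact (abs_apply_coordBasis_le _ _ _).trans
      (mul_le_mul le_rfl (norm_modelUnit_le hx) (norm_nonneg _) hnG)
  have h0 : 0 ≤ 2 * (nG (G := G) (c := c) + 𝓓.K₂) * μ (A := A) (L := L) * (nL (L := L) + 𝓓.K₁) := by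
    positivity
  calc _ ≤ _ := h
    _ ≤ 𝓓.Bu := by unfold Bu; linarith

/-- **`|u♭_a| ≤ B_u`.** [folklore] -/
theorem abs_lowUnit_le (hx : x ∈ ball c 𝓓.δ \ {c}) (a : Fin 4) :
    |lowUnit G Z x a| ≤ 𝓓.Bu := by
  have := 𝓓.K₁_nonneg; have := 𝓓.K₂_nonneg
  have hnL := nL_nonneg (d := 4) (L := L); have hnG := nG_nonneg (G := G) (c := c)
  have hμ := μ_nonneg (A := A) (L := L)
  have h : |lowUnit G Z x a| ≤
      (nG (G := G) (c := c) + 𝓓.K₂) * (2 * μ (A := A) (L := L) * (nL (L := L) + 𝓓.K₁)) := by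
    simp only [lowUnit, frameCovector_apply, ContinuousLinearMap.toLinearMap₁₂_apply]
    exact (abs_apply_coordBasis_le _ _ _).trans
      (mul_le_mul (norm_G_le hx) (norm_unit_le hx) (norm_nonneg _) (by positivity))
  have h0 : 0 ≤ nG (G := G) (c := c) * μ (A := A) (L := L) * nL (L := L) := by positivity
  calc _ ≤ _ := h
    _ ≤ 𝓓.Bu := by unfold Bu; linarith

/-- The constant `C_cov = C_du + 2K₃μ(‖L‖ + K₁)` of `‖∇û − Dû₀‖ ≤ C_cov`. [folklore] -/
def Ccov : ℝ := 𝓓.Cdu + 𝓓.K₃ * (2 * μ (A := A) (L := L) * (nL (L := L) + 𝓓.K₁))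

/-- `C_cov ≥ 0`. [folklore] -/
theorem Ccov_nonneg : 0 ≤ 𝓓.Ccov := by
  have := 𝓓.K₁_nonneg; have := 𝓓.K₃_nonneg; have := 𝓓.Cdu_nonneg
  have := nL_nonneg (d := 4) (L := L); have := μ_nonneg (A := A) (L := L)
  unfold Ccov; positivity

/-- **`∇û = Dû₀ + O(1)`**: `‖covDAt G û x − Dû₀‖ ≤ C_cov`. [folklore] -/
theorem norm_covDAt_unit_sub_le (hG : IsMetricOn G V) (hZ : ContDiffOn ℝ ∞ Z V)
    (hx : x ∈ ball c 𝓓.δ \ {c}) :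
    ‖covDAt G (metricUnitField G Z) x - modelUnitDeriv G c A L x‖ ≤ 𝓓.Ccov := by
  have hD := (hasFDerivAt_unit hG hZ hx).fderiv
  have hdec : covDAt G (metricUnitField G Z) x - modelUnitDeriv G c A L x =
      (unitDeriv G Z x - modelUnitDeriv G c A L x) + chrAt G x (metricUnitField G Z x) := by
    rw [covDAt, hD]; abel
  rw [hdec]
  have h2 : ‖chrAt G x (metricUnitField G Z x)‖ ≤
      𝓓.K₃ * (2 * μ (A := A) (L := L) * (nL (L := L) + 𝓓.K₁)) :=
    ((chrAt G x).le_opNorm _).trans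
      (mul_le_mul (𝓓.chrAt_le x hx.1) (norm_unit_le hx) (norm_nonneg _) 𝓓.K₃_nonneg)
  exact (norm_add_le _ _).trans (add_le_add (norm_unitDeriv_sub_le hx) h2)

/-- **`‖∇û‖ ≤ (M₀ + C_cov)/r`.** [folklore] -/
theorem norm_covDAt_unit_le (hG : IsMetricOn G V) (hZ : ContDiffOn ℝ ∞ Z V)
    (hx : x ∈ ball c 𝓓.δ \ {c}) :
    ‖covDAt G (metricUnitField G Z) x‖ ≤
      (M₀ (G := G) (c := c) (A := A) (L := L) + 𝓓.Ccov) / ‖x - c‖ := by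
  have hr := norm_pos hx
  have hr1 := norm_le_one hx
  have hC := 𝓓.Ccov_nonneg
  have h1 := norm_modelUnitDeriv_le hx (𝓓 := 𝓓)
  have h2 := norm_covDAt_unit_sub_le hG hZ hx
  have h3 : 𝓓.Ccov ≤ 𝓓.Ccov / ‖x - c‖ := by
    rw [le_div_iff₀ hr]
    exact mul_le_of_le_one_right hC hr1
  calc ‖covDAt G (metricUnitField G Z) x‖
      = ‖modelUnitDeriv G c A L x + (covDAt G (metricUnitField G Z) x - modelUnitDeriv G c A L x)‖ := by
        abel_nf
    _ ≤ M₀ (G := G) (c := c) (A := A) (L := L) / ‖x - c‖ + 𝓓.Ccov / ‖x - c‖ :=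
        (norm_add_le _ _).trans (add_le_add h1 (h2.trans h3))
    _ = _ := by ring

/-- The constant `C_N = K₂(M₀ + C_cov) + ‖G_c‖ C_cov` of `|N − N⁰| ≤ C_N`. [folklore] -/
def CN : ℝ := 𝓓.K₂ * (M₀ (G := G) (c := c) (A := A) (L := L) + 𝓓.Ccov) +
  nG (G := G) (c := c) * 𝓓.Ccov

/-- `C_N ≥ 0`. [folklore] -/
theorem CN_nonneg : 0 ≤ 𝓓.CN := by
  have := 𝓓.K₂_nonneg; have := 𝓓.Ccov_nonneg
  have := nG_nonneg (G := G) (c := c); have := M₀_nonneg (G := G) (c := c) (A := A) (L := L)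
  unfold CN; positivity

/-- **`N = N⁰ + O(1)`**: `|N_{ak} − N⁰_{ak}| ≤ C_N`. [folklore] -/
theorem abs_lowEndo_sub_le (hG : IsMetricOn G V) (hZ : ContDiffOn ℝ ∞ Z V)
    (hx : x ∈ ball c 𝓓.δ \ {c}) (a k : Fin 4) :
    |lowEndo G Z x a k - modelLowEndo G c A L x a k| ≤ 𝓓.CN := by
  have hr := norm_pos hx
  have hK₂ := 𝓓.K₂_nonneg; have hnG := nG_nonneg (G := G) (c := c)
  have hC := 𝓓.Ccov_nonneg; have hM := M₀_nonneg (G := G) (c := c) (A := A) (L := L)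
  set S := covDAt G (metricUnitField G Z) x with hS
  set S₀ := modelUnitDeriv G c A L x with hS₀
  have hdec : lowEndo G Z x a k - modelLowEndo G c A L x a k =
      (G x - G c) (S (coordBasis 4 k)) (coordBasis 4 a) +
        G c ((S - S₀) (coordBasis 4 k)) (coordBasis 4 a) := by
    simp only [lowEndo, modelLowEndo, frameEndo_apply, ContinuousLinearMap.toLinearMap₁₂_apply,
      ContinuousLinearMap.coe_coe, _root_.sub_apply, map_sub, ← hS, ← hS₀]
    ring
  rw [hdec]
  have h1 : |(G x - G c) (S (coordBasis 4 k)) (coordBasis 4 a)| ≤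
      (𝓓.K₂ * ‖x - c‖) * ((M₀ (G := G) (c := c) (A := A) (L := L) + 𝓓.Ccov) / ‖x - c‖) :=
    (abs_apply_coordBasis_le _ _ _).trans (mul_le_mul (𝓓.metric_lip x hx.1)
      ((norm_apply_coordBasis_le _ _).trans (norm_covDAt_unit_le hG hZ hx)) (norm_nonneg _)
      (by positivity))
  have h2 : |G c ((S - S₀) (coordBasis 4 k)) (coordBasis 4 a)| ≤ nG (G := G) (c := c) * 𝓓.Ccov :=
    (abs_apply_coordBasis_le _ _ _).trans (mul_le_mul le_rfl
      ((norm_apply_coordBasis_le _ _).trans (norm_covDAt_unit_sub_le hG hZ hx)) (norm_nonneg _) hnG)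
  calc _ ≤ _ := abs_add_le _ _
    _ ≤ _ := add_le_add h1 h2
    _ = 𝓓.CN := by unfold CN; field_simp

/-- The constant `B_ν = (‖G_c‖ + K₂)(M₀ + C_cov) + ‖G_c‖ M₀` of the common bound `B_ν/r` for
`|N|`, `|N⁰|`. [folklore] -/
def Bν : ℝ := (nG (G := G) (c := c) + 𝓓.K₂) * (M₀ (G := G) (c := c) (A := A) (L := L) + 𝓓.Ccov) +
  nG (G := G) (c := c) * M₀ (G := G) (c := c) (A := A) (L := L)

/-- `B_ν ≥ 0`. [folklore] -/
theorem Bν_nonneg : 0 ≤ 𝓓.Bν := by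
  have := 𝓓.K₂_nonneg; have := 𝓓.Ccov_nonneg
  have := nG_nonneg (G := G) (c := c); have := M₀_nonneg (G := G) (c := c) (A := A) (L := L)
  unfold Bν; positivity

/-- **`|N_{ak}| ≤ B_ν/r`.** [folklore] -/
theorem abs_lowEndo_le (hG : IsMetricOn G V) (hZ : ContDiffOn ℝ ∞ Z V)
    (hx : x ∈ ball c 𝓓.δ \ {c}) (a k : Fin 4) :
    |lowEndo G Z x a k| ≤ 𝓓.Bν / ‖x - c‖ := by
  have hr := norm_pos hx
  have hK₂ := 𝓓.K₂_nonneg; have hnG := nG_nonneg (G := G) (c := c)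
  have hC := 𝓓.Ccov_nonneg; have hM := M₀_nonneg (G := G) (c := c) (A := A) (L := L)
  have h : |lowEndo G Z x a k| ≤ (nG (G := G) (c := c) + 𝓓.K₂) *
      ((M₀ (G := G) (c := c) (A := A) (L := L) + 𝓓.Ccov) / ‖x - c‖) := by
    simp only [lowEndo, frameEndo_apply, ContinuousLinearMap.toLinearMap₁₂_apply,
      ContinuousLinearMap.coe_coe]
    exact (abs_apply_coordBasis_le _ _ _).trans (mul_le_mul (norm_G_le hx)
      ((norm_apply_coordBasis_le _ _).trans (norm_covDAt_unit_le hG hZ hx)) (norm_nonneg _)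
      (by positivity))
  calc _ ≤ _ := h
    _ ≤ 𝓓.Bν / ‖x - c‖ := by
        unfold Bν
        rw [← mul_div_assoc, div_le_div_iff_of_pos_right hr]
        nlinarith

/-- **`|N⁰_{ak}| ≤ B_ν/r`.** [folklore] -/
theorem abs_modelLowEndo_le (hx : x ∈ ball c 𝓓.δ \ {c}) (a k : Fin 4) :
    |modelLowEndo G c A L x a k| ≤ 𝓓.Bν / ‖x - c‖ := by
  have hr := norm_pos hx
  have hK₂ := 𝓓.K₂_nonneg; have hnG := nG_nonneg (G := G) (c := c)
  have hC := 𝓓.Ccov_nonneg; have hM := M₀_nonneg (G := G) (c := c) (A := A) (L := L)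
  have h : |modelLowEndo G c A L x a k| ≤ nG (G := G) (c := c) *
      (M₀ (G := G) (c := c) (A := A) (L := L) / ‖x - c‖) := by
    simp only [modelLowEndo, frameEndo_apply, ContinuousLinearMap.toLinearMap₁₂_apply,
      ContinuousLinearMap.coe_coe]
    exact (abs_apply_coordBasis_le _ _ _).trans (mul_le_mul le_rfl
      ((norm_apply_coordBasis_le _ _).trans (norm_modelUnitDeriv_le hx (𝓓 := 𝓓))) (norm_nonneg _)
      hnG)
  calc _ ≤ _ := h
    _ ≤ 𝓓.Bν / ‖x - c‖ := by
        unfold Bν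
        rw [← mul_div_assoc, div_le_div_iff_of_pos_right hr]
        nlinarith

/-- **The curvature array is bounded**: `|W_{ackl}| ≤ (‖G_c‖ + K₂) K` when
`‖R_x(e_k, e_l)e_c‖ ≤ K`. [folklore] -/
theorem abs_curvArray_le (hx : x ∈ ball c 𝓓.δ \ {c}) {K : ℝ}
    (hW : ∀ k l b : Fin 4, ‖riemAt G x (coordBasis 4 k) (coordBasis 4 l) (coordBasis 4 b)‖ ≤ K)
    (a b k l : Fin 4) :
    |curvArray G x a b k l| ≤ (nG (G := G) (c := c) + 𝓓.K₂) * K := by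
  simp only [curvArray, frameCurv_apply, riemAtₗ_apply, ContinuousLinearMap.toLinearMap₁₂_apply]
  exact (abs_apply_coordBasis_le _ _ _).trans
    (mul_le_mul (norm_G_le hx) (hW k l b) (norm_nonneg _)
      (by have := 𝓓.K₂_nonneg; have := nG_nonneg (G := G) (c := c); positivity))

end ChernZeroData

/-! ### The model arrays in matrix form and the value of the model sum `T₀⁰` -/

/-- `((g L̃) ỹ)_a = G_c(L v, e_a)` for the Gram matrix `g` at `c`, the matrix `L̃` of `L` and the
coordinates `ỹ` of `v` in the standard basis. [folklore] -/
theorem gram_mul_toMatrix_mulVec (hs : ∀ v w, G c v w = G c w v) (v : 𝔼 4) (a : Fin 4) :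
    ((gramStd G c * LinearMap.toMatrix (coordBasis 4) (coordBasis 4) (L : (𝔼 4) →ₗ[ℝ] (𝔼 4))) *ᵥ
      ⇑((coordBasis 4).repr v)) a = G c (L v) (coordBasis 4 a) := by
  rw [← Matrix.mulVec_mulVec, LinearMap.toMatrix_mulVec_repr]
  have hrepr : (⇑((coordBasis 4).repr ((L : (𝔼 4) →ₗ[ℝ] (𝔼 4)) v)) : Fin 4 → ℝ) = ofLp (L v) := by
    funext i
    rw [stdBasis_repr]
    rfl
  rw [hrepr, gramStd, frameGram_coordBasis, metricMatrix_mulVec hs]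

/-- `(g L̃)_{ak} = G_c(L e_k, e_a)`. [folklore] -/
theorem gram_mul_toMatrix_apply (hs : ∀ v w, G c v w = G c w v) (a k : Fin 4) :
    (gramStd G c * LinearMap.toMatrix (coordBasis 4) (coordBasis 4) (L : (𝔼 4) →ₗ[ℝ] (𝔼 4))) a k =
      G c (L (coordBasis 4 k)) (coordBasis 4 a) := by
  have h := gram_mul_toMatrix_mulVec (L := L) hs (coordBasis 4 k) a
  rw [Module.Basis.repr_self, Finsupp.single_eq_pi_single] at h
  rw [← h]
  simp only [Matrix.mulVec, dotProduct, Pi.single_apply, mul_ite, mul_one, mul_zero,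
    Finset.sum_ite_eq', Finset.mem_univ, if_true]

/-- **The model sum** (Chern 1945, §2): `T₀⁰(i) = 6 ρ⁻⁴ det g_c · det L · (x − c)ᵢ`
(`chernSum₀_model` applied to the matrix forms `u♭⁰ = ρ⁻¹ (g_c L̃) ỹ`,
`N⁰ = ρ⁻¹ (g_c L̃ − u♭⁰ ⊗ z)`). [cite: Chern1945, §2, (14)-(16)] -/
theorem chernSum₀_modelLow (hs : ∀ v w, G c v w = G c w v) (x : 𝔼 4) (i : Fin 4) :
    chernSum₀ (modelLowUnit G c A L x) (modelLowEndo G c A L x) i =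
      6 * ‖A (L (x - c))‖⁻¹ ^ 4 * (gramStd G c).det * LinearMap.det (L : (𝔼 4) →ₗ[ℝ] (𝔼 4)) *
        (x - c) i := by
  set ρ := ‖A (L (x - c))‖ with hρ
  set Lm := LinearMap.toMatrix (coordBasis 4) (coordBasis 4) (L : (𝔼 4) →ₗ[ℝ] (𝔼 4)) with hLm
  set y : Fin 4 → ℝ := ⇑((coordBasis 4).repr (x - c)) with hy
  set z : Fin 4 → ℝ := fun k ↦ ρ⁻¹ * G c (L (coordBasis 4 k)) (L (x - c)) with hz
  have hu : modelLowUnit G c A L x = ρ⁻¹ • (gramStd G c * Lm) *ᵥ y := by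
    funext a
    rw [Pi.smul_apply, gram_mul_toMatrix_mulVec hs, smul_eq_mul]
    simp only [modelLowUnit, modelUnit, frameCovector_apply, map_smul, LinearMap.smul_apply,
      ContinuousLinearMap.toLinearMap₁₂_apply, smul_eq_mul, ← hρ]
  have hN : modelLowEndo G c A L x =
      ρ⁻¹ • (gramStd G c * Lm - vecMulVec (ρ⁻¹ • (gramStd G c * Lm) *ᵥ y) z) := by
    ext a k
    rw [Matrix.smul_apply, Matrix.sub_apply, vecMulVec_apply, Pi.smul_apply,
      gram_mul_toMatrix_apply hs, gram_mul_toMatrix_mulVec hs, smul_eq_mul, smul_eq_mul, hz]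
    simp only [modelLowEndo, frameEndo_apply, ContinuousLinearMap.coe_coe, modelUnitDeriv,
      modelSqDeriv, _root_.add_apply, FunLike.coe_smul, Pi.smul_apply,
      ContinuousLinearMap.smulRight_apply, ContinuousLinearMap.comp_apply, flip_apply,
      ContinuousLinearEquiv.coe_coe, smul_eq_mul, map_add, map_smul, LinearMap.add_apply,
      LinearMap.smul_apply, ContinuousLinearMap.toLinearMap₁₂_apply, ← hρ]
    ring
  rw [hu, hN, chernSum₀_model, hLm, LinearMap.det_toMatrix, hy, stdBasis_repr]

/-! ### Bounds for Chern's sums -/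

section Algebra

open Equiv Equiv.Perm

/-- `|a b e f| ≤ A B E F` from entrywise bounds. [folklore] -/
theorem abs_mul₄_le {a b e f A' B' E' F' : ℝ} (ha : |a| ≤ A') (hb : |b| ≤ B') (he : |e| ≤ E')
    (hf : |f| ≤ F') : |a * b * e * f| ≤ A' * B' * E' * F' := by
  rw [abs_mul, abs_mul, abs_mul]
  have hA : 0 ≤ A' := (abs_nonneg _).trans ha
  have hB : 0 ≤ B' := (abs_nonneg _).trans hb
  have hE : 0 ≤ E' := (abs_nonneg _).trans he
  exact mul_le_mul (mul_le_mul (mul_le_mul ha hb (abs_nonneg _) hA) he (abs_nonneg _)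
    (mul_nonneg hA hB)) hf (abs_nonneg _) (mul_nonneg (mul_nonneg hA hB) hE)

/-- `|a b e| ≤ A B E` from entrywise bounds. [folklore] -/
theorem abs_mul₃_le {a b e A' B' E' : ℝ} (ha : |a| ≤ A') (hb : |b| ≤ B') (he : |e| ≤ E') :
    |a * b * e| ≤ A' * B' * E' := by
  rw [abs_mul, abs_mul]
  have hA : 0 ≤ A' := (abs_nonneg _).trans ha
  have hB : 0 ≤ B' := (abs_nonneg _).trans hb
  exact mul_le_mul (mul_le_mul ha hb (abs_nonneg _) hA) he (abs_nonneg _) (mul_nonneg hA hB)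

/-- `|sgn σ · sgn τ · t| = |t|`. [folklore] -/
theorem abs_sign_mul_sign_mul (σ τ : Perm (Fin 4)) (t : ℝ) :
    |((sign σ : ℤ) : ℝ) * ((sign τ : ℤ) : ℝ) * t| = |t| := by
  rw [abs_mul, abs_mul, abs_unit_intCast, abs_unit_intCast, one_mul, one_mul]

/-- A double sum over `𝔖₄ × 𝔖₄` of terms bounded by `B` is bounded by `576 B`. [folklore] -/
theorem abs_sum_perm_perm_le {f : Perm (Fin 4) → Perm (Fin 4) → ℝ} {B : ℝ}
    (hf : ∀ σ τ, |f σ τ| ≤ B) : |∑ σ : Perm (Fin 4), ∑ τ : Perm (Fin 4), f σ τ| ≤ 576 * B := by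
  calc |∑ σ, ∑ τ, f σ τ| ≤ ∑ σ, |∑ τ, f σ τ| := Finset.abs_sum_le_sum_abs _ _
    _ ≤ ∑ σ, ∑ τ, |f σ τ| := Finset.sum_le_sum fun σ _ ↦ Finset.abs_sum_le_sum_abs _ _
    _ ≤ ∑ _σ : Perm (Fin 4), ∑ _τ : Perm (Fin 4), B :=
        Finset.sum_le_sum fun σ _ ↦ Finset.sum_le_sum fun τ _ ↦ hf σ τ
    _ = 24 * (24 * B) := by
        simp only [Finset.sum_const, Finset.card_univ, Fintype.card_perm, Fintype.card_fin,
          nsmul_eq_mul]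
        norm_num [Nat.factorial]
    _ = 576 * B := by ring

/-- **Telescoping bound for `T₀`**: if `|u♭|, |u♭'| ≤ α`, `|u♭ − u♭'| ≤ α'`, `|N|, |N'| ≤ ν`,
`|N − N'| ≤ ν'` entrywise then `|T₀(u♭, N) − T₀(u♭', N')| ≤ 576 (α' ν³ + 3 α ν² ν')`.
[folklore] -/
theorem abs_chernSum₀_sub_le {uL uL' : Fin 4 → ℝ} {N N' : Matrix (Fin 4) (Fin 4) ℝ}
    {α α' ν ν' : ℝ} (hu : ∀ a, |uL a| ≤ α) (hu' : ∀ a, |uL' a| ≤ α)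
    (huu : ∀ a, |uL a - uL' a| ≤ α') (hN : ∀ a k, |N a k| ≤ ν) (hN' : ∀ a k, |N' a k| ≤ ν)
    (hNN : ∀ a k, |N a k - N' a k| ≤ ν') (i : Fin 4) :
    |chernSum₀ uL N i - chernSum₀ uL' N' i| ≤ 576 * (α' * ν ^ 3 + 3 * α * ν ^ 2 * ν') := by
  have hα : 0 ≤ α := (abs_nonneg _).trans (hu 0)
  have hα' : 0 ≤ α' := (abs_nonneg _).trans (huu 0)
  have hν : 0 ≤ ν := (abs_nonneg _).trans (hN 0 0)
  have hν' : 0 ≤ ν' := (abs_nonneg _).trans (hNN 0 0)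
  rw [chernSum₀_eq_sum, chernSum₀_eq_sum, ← Finset.sum_sub_distrib]
  simp_rw [← Finset.sum_sub_distrib]
  refine abs_sum_perm_perm_le fun σ τ ↦ ?_
  split_ifs with h
  · rw [← mul_sub, abs_sign_mul_sign_mul]
    have key : uL (σ 0) * (N (σ 1) (τ 1) * N (σ 2) (τ 2) * N (σ 3) (τ 3)) -
        uL' (σ 0) * (N' (σ 1) (τ 1) * N' (σ 2) (τ 2) * N' (σ 3) (τ 3)) =
        (uL (σ 0) - uL' (σ 0)) * N (σ 1) (τ 1) * N (σ 2) (τ 2) * N (σ 3) (τ 3) +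
        uL' (σ 0) * (N (σ 1) (τ 1) - N' (σ 1) (τ 1)) * N (σ 2) (τ 2) * N (σ 3) (τ 3) +
        uL' (σ 0) * N' (σ 1) (τ 1) * (N (σ 2) (τ 2) - N' (σ 2) (τ 2)) * N (σ 3) (τ 3) +
        uL' (σ 0) * N' (σ 1) (τ 1) * N' (σ 2) (τ 2) * (N (σ 3) (τ 3) - N' (σ 3) (τ 3)) := by ring
    rw [key]
    have h1 := abs_mul₄_le (huu (σ 0)) (hN (σ 1) (τ 1)) (hN (σ 2) (τ 2)) (hN (σ 3) (τ 3))
    have h2 := abs_mul₄_le (hu' (σ 0)) (hNN (σ 1) (τ 1)) (hN (σ 2) (τ 2)) (hN (σ 3) (τ 3))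
    have h3 := abs_mul₄_le (hu' (σ 0)) (hN' (σ 1) (τ 1)) (hNN (σ 2) (τ 2)) (hN (σ 3) (τ 3))
    have h4 := abs_mul₄_le (hu' (σ 0)) (hN' (σ 1) (τ 1)) (hN' (σ 2) (τ 2)) (hNN (σ 3) (τ 3))
    calc _ ≤ α' * ν * ν * ν + α * ν' * ν * ν + α * ν * ν' * ν + α * ν * ν * ν' :=
          (abs_add_le _ _).trans (add_le_add ((abs_add_le _ _).trans (add_le_add
            ((abs_add_le _ _).trans (add_le_add h1 h2)) h3)) h4)
      _ = _ := by ring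
  · rw [sub_zero, abs_zero]
    positivity

/-- **Bound for `T₀`**: `|T₀(u♭, N)| ≤ 576 α ν³`. [folklore] -/
theorem abs_chernSum₀_le {uL : Fin 4 → ℝ} {N : Matrix (Fin 4) (Fin 4) ℝ} {α ν : ℝ}
    (hu : ∀ a, |uL a| ≤ α) (hN : ∀ a k, |N a k| ≤ ν) (i : Fin 4) :
    |chernSum₀ uL N i| ≤ 576 * (α * ν ^ 3) := by
  have hα : 0 ≤ α := (abs_nonneg _).trans (hu 0)
  have hν : 0 ≤ ν := (abs_nonneg _).trans (hN 0 0)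
  rw [chernSum₀_eq_sum]
  refine abs_sum_perm_perm_le fun σ τ ↦ ?_
  split_ifs with h
  · rw [abs_sign_mul_sign_mul]
    have h1 := abs_mul₄_le (hu (σ 0)) (hN (σ 1) (τ 1)) (hN (σ 2) (τ 2)) (hN (σ 3) (τ 3))
    calc _ = |uL (σ 0) * N (σ 1) (τ 1) * N (σ 2) (τ 2) * N (σ 3) (τ 3)| := by ring_nf
      _ ≤ α * ν * ν * ν := h1
      _ = _ := by ring
  · rw [abs_zero]
    positivity

/-- **Bound for `T₁`**: `|T₁(u♭, W, N)| ≤ 576 α w ν`. [folklore] -/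
theorem abs_chernSum₁_le {uL : Fin 4 → ℝ} {W : Fin 4 → Fin 4 → Fin 4 → Fin 4 → ℝ}
    {N : Matrix (Fin 4) (Fin 4) ℝ} {α w ν : ℝ}
    (hu : ∀ a, |uL a| ≤ α) (hW : ∀ a b k l, |W a b k l| ≤ w) (hN : ∀ a k, |N a k| ≤ ν) (i : Fin 4) :
    |chernSum₁ uL W N i| ≤ 576 * (α * w * ν) := by
  have hα : 0 ≤ α := (abs_nonneg _).trans (hu 0)
  have hw : 0 ≤ w := (abs_nonneg _).trans (hW 0 0 0 0)
  have hν : 0 ≤ ν := (abs_nonneg _).trans (hN 0 0)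
  rw [chernSum₁_eq_sum]
  refine abs_sum_perm_perm_le fun σ τ ↦ ?_
  split_ifs with h
  · rw [abs_sign_mul_sign_mul]
    exact abs_mul₃_le (hu (σ 0)) (hW _ _ _ _) (hN (σ 3) (τ 3))
  · rw [abs_zero]
    positivity

/-- **The final combination**: with `|dI| ≤ 2/d₀`, `|dI − dI₀| ≤ 2K_d r/d₀²`,
`|T₀ − T₀'| ≤ E₀/r²`, `|T₀'| ≤ E₀'/r³`, `|T₁| ≤ E₁/r` (`0 < r ≤ 1`),
`|−dI(⅓T₀ + ¼T₁) + dI₀ ⅓T₀'| ≤ (⅔E₀/d₀ + ⅔K_dE₀'/d₀² + ½E₁/d₀)/r²`. [folklore] -/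
theorem abs_chernVec_comb_le {dI dI₀ T₀ T₀' T₁ r d₀ Kd E₀ E₀' E₁ : ℝ} (hr : 0 < r) (hr1 : r ≤ 1)
    (hd₀ : 0 < d₀) (hKd : 0 ≤ Kd) (hE₁ : 0 ≤ E₁)
    (hdI : |dI| ≤ 2 / d₀) (hdd : |dI - dI₀| ≤ 2 * Kd * r / d₀ ^ 2)
    (h₀ : |T₀ - T₀'| ≤ E₀ / r ^ 2) (h₀' : |T₀'| ≤ E₀' / r ^ 3) (h₁ : |T₁| ≤ E₁ / r) :
    |-(dI * (3⁻¹ * T₀ + 4⁻¹ * T₁)) - -(dI₀ * (3⁻¹ * T₀'))| ≤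
      (2 / 3 * E₀ / d₀ + 2 / 3 * Kd * E₀' / d₀ ^ 2 + 2⁻¹ * E₁ / d₀) / r ^ 2 := by
  have hE₀ : 0 ≤ E₀ / r ^ 2 := (abs_nonneg _).trans h₀
  have hE₀' : 0 ≤ E₀' / r ^ 3 := (abs_nonneg _).trans h₀'
  have key : -(dI * (3⁻¹ * T₀ + 4⁻¹ * T₁)) - -(dI₀ * (3⁻¹ * T₀')) =
      -(3⁻¹ * (dI * (T₀ - T₀')) + 3⁻¹ * ((dI - dI₀) * T₀') + 4⁻¹ * (dI * T₁)) := by ring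
  rw [key, abs_neg]
  have p1 : |3⁻¹ * (dI * (T₀ - T₀'))| ≤ 3⁻¹ * (2 / d₀ * (E₀ / r ^ 2)) := by
    rw [abs_mul, abs_mul, abs_of_pos (by norm_num : (0 : ℝ) < 3⁻¹)]
    exact mul_le_mul_of_nonneg_left (mul_le_mul hdI h₀ (abs_nonneg _) (by positivity))
      (by norm_num)
  have p2 : |3⁻¹ * ((dI - dI₀) * T₀')| ≤ 3⁻¹ * (2 * Kd * r / d₀ ^ 2 * (E₀' / r ^ 3)) := by
    rw [abs_mul, abs_mul, abs_of_pos (by norm_num : (0 : ℝ) < 3⁻¹)]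
    exact mul_le_mul_of_nonneg_left (mul_le_mul hdd h₀' (abs_nonneg _) (by positivity))
      (by norm_num)
  have h₁' : |T₁| ≤ E₁ / r ^ 2 :=
    h₁.trans (div_le_div_of_nonneg_left hE₁ (by positivity) (by nlinarith))
  have p3 : |4⁻¹ * (dI * T₁)| ≤ 4⁻¹ * (2 / d₀ * (E₁ / r ^ 2)) := by
    rw [abs_mul, abs_mul, abs_of_pos (by norm_num : (0 : ℝ) < 4⁻¹)]
    exact mul_le_mul_of_nonneg_left (mul_le_mul hdI h₁' (abs_nonneg _) (by positivity))
      (by norm_num)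
  calc _ ≤ |3⁻¹ * (dI * (T₀ - T₀'))| + |3⁻¹ * ((dI - dI₀) * T₀')| + |4⁻¹ * (dI * T₁)| :=
        abs_add_three _ _ _
    _ ≤ 3⁻¹ * (2 / d₀ * (E₀ / r ^ 2)) + 3⁻¹ * (2 * Kd * r / d₀ ^ 2 * (E₀' / r ^ 3)) +
        4⁻¹ * (2 / d₀ * (E₁ / r ^ 2)) := add_le_add (add_le_add p1 p2) p3
    _ = _ := by field_simp; ring

/-- `‖v‖ ≤ 2B` for `v ∈ ℝ⁴` with `|vᵢ| ≤ B`. [folklore] -/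
theorem norm_le_two_mul_of_abs_apply_le {v : 𝔼 4} {B : ℝ} (hB : 0 ≤ B) (h : ∀ i, |v i| ≤ B) :
    ‖v‖ ≤ 2 * B := by
  have hsq : ‖v‖ ^ 2 ≤ (2 * B) ^ 2 := by
    rw [EuclideanSpace.real_norm_sq_eq]
    calc ∑ i, v i ^ 2 ≤ ∑ _i : Fin 4, B ^ 2 := Finset.sum_le_sum fun i _ ↦ by
            rw [← sq_abs]
            exact pow_le_pow_left₀ (abs_nonneg _) (h i) 2
      _ = (2 * B) ^ 2 := by
          rw [Finset.sum_const, Finset.card_univ, Fintype.card_fin, nsmul_eq_mul]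
          push_cast
          ring
  exact (pow_le_pow_iff_left₀ (norm_nonneg _) (by positivity) two_ne_zero).1 hsq

end Algebra

/-! ### The curvature and determinant data, and the remainder estimate -/

variable (G c A Z L) (V : Set (𝔼 4))

/-- The primitive estimates together with a bound for the curvature on the ball and the
Lipschitz/lower bounds for the Gram determinant. [folklore] -/
structure ChernZeroData₄ extends ChernZeroData G V c A Z L where
  /-- bound for `‖R_x(e_k, e_l)e_b‖` -/
  K₅ : ℝ
  /-- Lipschitz constant of `det g` at `c` -/
  Kd : ℝ
  K₅_nonneg : 0 ≤ K₅
  Kd_nonneg : 0 ≤ Kd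
  riem_le : ∀ x ∈ ball c δ, ∀ k l b : Fin 4,
    ‖riemAt G x (coordBasis 4 k) (coordBasis 4 l) (coordBasis 4 b)‖ ≤ K₅
  det_pos : 0 < (gramStd G c).det
  det_lip : ∀ x ∈ ball c δ, |(gramStd G x).det - (gramStd G c).det| ≤ Kd * ‖x - c‖
  det_ge : ∀ x ∈ ball c δ, (gramStd G c).det / 2 ≤ (gramStd G x).det

variable {G c A Z L V}

/-- Restricting the primitive estimates to a smaller ball. [folklore] -/
def ChernZeroData.restrict {d : ℕ} {G : (𝔼 d) → (𝔼 d) →L[ℝ] (𝔼 d) →L[ℝ] ℝ} {V : Set (𝔼 d)} {c : 𝔼 d}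
    {A : (𝔼 d) ≃L[ℝ] (𝔼 d)} {Z : (𝔼 d) → (𝔼 d)} {L : (𝔼 d) ≃L[ℝ] (𝔼 d)}
    (𝓓 : ChernZeroData G V c A Z L) (δ' : ℝ) (h0 : 0 < δ') (hle : δ' ≤ 𝓓.δ) :
    ChernZeroData G V c A Z L where
  δ := δ'
  K₁ := 𝓓.K₁
  K₂ := 𝓓.K₂
  K₃ := 𝓓.K₃
  K₄ := 𝓓.K₄
  Cq := 𝓓.Cq
  δ_pos := h0
  δ_le_one := hle.trans 𝓓.δ_le_one
  K₁_nonneg := 𝓓.K₁_nonneg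
  K₂_nonneg := 𝓓.K₂_nonneg
  K₃_nonneg := 𝓓.K₃_nonneg
  K₄_nonneg := 𝓓.K₄_nonneg
  Cq_nonneg := 𝓓.Cq_nonneg
  ball_subset := (ball_subset_ball hle).trans 𝓓.ball_subset
  taylor := fun x hx ↦ 𝓓.taylor x (ball_subset_ball hle hx)
  metric_lip := fun x hx ↦ 𝓓.metric_lip x (ball_subset_ball hle hx)
  chrAt_le := fun x hx ↦ 𝓓.chrAt_le x (ball_subset_ball hle hx)
  fderiv_le := fun x hx ↦ 𝓓.fderiv_le x (ball_subset_ball hle hx)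
  sq_sub_le := fun x hx ↦ 𝓓.sq_sub_le x ⟨ball_subset_ball hle hx.1, hx.2⟩
  sq_le_two_mul := fun x hx ↦ 𝓓.sq_le_two_mul x ⟨ball_subset_ball hle hx.1, hx.2⟩
  le_two_mul_sq := fun x hx ↦ 𝓓.le_two_mul_sq x ⟨ball_subset_ball hle hx.1, hx.2⟩

/-- `G_c` is positive definite when `G_c(v, w) = ⟨Av, Aw⟩`. [folklore] -/
theorem pos_of_gram_eq (hA : ∀ v w, G c v w = ⟪A v, A w⟫) (v : 𝔼 4) (hv : v ≠ 0) : 0 < G c v v := by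
  rw [hA, real_inner_self_eq_norm_sq]
  have : A v ≠ 0 := fun h ↦ hv (A.injective (by rw [h, map_zero]))
  positivity

set_option maxHeartbeats 400000 in
/-- **Existence of the full local data** at a nondegenerate zero. [folklore] -/
theorem exists_chernZeroData₄ (hG : IsMetricOn G V) (hc : c ∈ V) (hA : ∀ v w, G c v w = ⟪A v, A w⟫)
    (hZ : ContDiffOn ℝ ∞ Z V) (hZc : Z c = 0) (hL : fderiv ℝ Z c = L) :
    Nonempty (ChernZeroData₄ G c A Z L V) := by
  obtain ⟨𝓓⟩ := exists_chernZeroData hG hc hA hZ hZc hL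
  -- the curvature bound
  set K₅ : ℝ := ∑ p : Fin 4 × Fin 4 × Fin 4,
    ‖riemAt G c (coordBasis 4 p.1) (coordBasis 4 p.2.1) (coordBasis 4 p.2.2)‖ + 1 with hK₅
  have hK₅0 : 0 ≤ K₅ := by positivity
  have hWev : ∀ᶠ x in 𝓝 c, ∀ p : Fin 4 × Fin 4 × Fin 4,
      ‖riemAt G x (coordBasis 4 p.1) (coordBasis 4 p.2.1) (coordBasis 4 p.2.2)‖ ≤ K₅ := by
    refine Filter.eventually_all.2 fun p ↦ ?_
    have hcont : ContinuousAt
        (fun x ↦ riemAt G x (coordBasis 4 p.1) (coordBasis 4 p.2.1) (coordBasis 4 p.2.2)) c :=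
      ((hG.contDiffOn_riemAt_apply _ _ _ c hc).contDiffAt (hG.mem_nhds hc)).continuousAt
    have hle : ‖riemAt G c (coordBasis 4 p.1) (coordBasis 4 p.2.1) (coordBasis 4 p.2.2)‖ + 1 ≤ K₅ := by
      have := Finset.single_le_sum (f := fun p : Fin 4 × Fin 4 × Fin 4 ↦
        ‖riemAt G c (coordBasis 4 p.1) (coordBasis 4 p.2.1) (coordBasis 4 p.2.2)‖)
        (fun _ _ ↦ norm_nonneg _) (Finset.mem_univ p)
      rw [hK₅]
      linarith
    exact (hcont.norm.eventually_lt_const (lt_add_one _)).mono fun x hx ↦ (le_of_lt hx).trans hle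
  obtain ⟨δ₅, hδ₅, h₅⟩ := Metric.eventually_nhds_iff_ball.1 hWev
  -- the determinant
  have hdetC : ContDiffAt ℝ ∞ (fun x ↦ (gramStd G x).det) c :=
    contDiffAt_det_of_entries fun i j ↦ contDiffAt_frameGram_entry hG hc i j
  obtain ⟨Kd, t, ht, hlip⟩ := (hdetC.of_le (by simp : (1 : WithTop ℕ∞) ≤ ∞)).exists_lipschitzOnWith
  obtain ⟨δd, hδd, hballd⟩ := Metric.mem_nhds_iff.1 ht
  have hct : c ∈ t := hballd (mem_ball_self hδd)
  set d₀ : ℝ := (gramStd G c).det with hd₀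
  have hd₀pos : 0 < d₀ := by
    rw [hd₀, gramStd, frameGram_coordBasis]
    exact (posDef_metricMatrix (hG.symm c hc) (pos_of_gram_eq hA)).det_pos
  set δ₆ : ℝ := d₀ / (2 * Kd + 1) with hδ₆
  have hδ₆pos : 0 < δ₆ := by positivity
  -- the radius
  set δ' : ℝ := min 𝓓.δ (min δ₅ (min δd δ₆)) with hδ'
  have hδ'pos : 0 < δ' := by
    have := 𝓓.δ_pos
    positivity
  have h1 : δ' ≤ 𝓓.δ := min_le_left _ _
  have h2 : δ' ≤ δ₅ := (min_le_right _ _).trans (min_le_left _ _)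
  have h3 : δ' ≤ δd := (min_le_right _ _).trans ((min_le_right _ _).trans (min_le_left _ _))
  have h4 : δ' ≤ δ₆ := (min_le_right _ _).trans ((min_le_right _ _).trans (min_le_right _ _))
  have hlipx : ∀ x ∈ ball c δ', |(gramStd G x).det - (gramStd G c).det| ≤ Kd * ‖x - c‖ := by
    intro x hx
    have h := hlip.dist_le_mul x (hballd (ball_subset_ball h3 hx)) c hct
    rwa [Real.dist_eq, dist_eq_norm] at h
  refine ⟨{ toChernZeroData := 𝓓.restrict δ' hδ'pos h1
            K₅ := K₅
            Kd := Kd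
            K₅_nonneg := hK₅0
            Kd_nonneg := Kd.2
            riem_le := fun x hx k l b ↦ h₅ x (ball_subset_ball h2 hx) (k, l, b)
            det_pos := hd₀pos
            det_lip := hlipx
            det_ge := fun x hx ↦ ?_ }⟩
  have hl := hlipx x hx
  have hr : ‖x - c‖ < δ₆ := lt_of_lt_of_le (mem_ball_iff_norm.1 hx) h4
  have hKr : (Kd : ℝ) * ‖x - c‖ ≤ d₀ / 2 := by
    calc (Kd : ℝ) * ‖x - c‖ ≤ Kd * δ₆ := by gcongr
      _ = Kd * d₀ / (2 * Kd + 1) := by rw [hδ₆]; ring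
      _ ≤ d₀ / 2 := by
          rw [div_le_div_iff₀ (by positivity) (by norm_num)]
          nlinarith [Kd.2]
  have := abs_le.1 (hl.trans hKr)
  rw [← hd₀]
  linarith

namespace ChernZeroData₄

variable {𝓓 : ChernZeroData₄ G c A Z L V} {x : 𝔼 4}

/-- **`|(det g_x)⁻¹| ≤ 2/det g_c`.** [folklore] -/
theorem abs_inv_det_le (hx : x ∈ ball c 𝓓.δ) : |((gramStd G x).det)⁻¹| ≤ 2 / (gramStd G c).det := by
  have h0 := 𝓓.det_pos
  have h := 𝓓.det_ge x hx
  have hx0 : 0 < (gramStd G x).det := by linarith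
  rw [abs_of_pos (inv_pos.2 hx0), inv_eq_one_div, div_le_div_iff₀ hx0 h0]
  linarith

/-- **`|(det g_x)⁻¹ − (det g_c)⁻¹| ≤ 2K_d r/(det g_c)²`.** [folklore] -/
theorem abs_inv_det_sub_le (hx : x ∈ ball c 𝓓.δ) :
    |((gramStd G x).det)⁻¹ - ((gramStd G c).det)⁻¹| ≤ 2 * 𝓓.Kd * ‖x - c‖ / (gramStd G c).det ^ 2 := by
  have h0 := 𝓓.det_pos
  have h := 𝓓.det_ge x hx
  have hl := 𝓓.det_lip x hx
  have hKd := 𝓓.Kd_nonneg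
  have hx0 : 0 < (gramStd G x).det := by linarith
  rw [inv_sub_inv hx0.ne' h0.ne', abs_div, abs_of_pos (mul_pos hx0 h0), abs_sub_comm,
    div_le_div_iff₀ (mul_pos hx0 h0) (by positivity)]
  calc |(gramStd G x).det - (gramStd G c).det| * (gramStd G c).det ^ 2
      ≤ 𝓓.Kd * ‖x - c‖ * (gramStd G c).det ^ 2 := by gcongr
    _ = 2 * 𝓓.Kd * ‖x - c‖ * ((gramStd G c).det / 2 * (gramStd G c).det) := by ring
    _ ≤ 2 * 𝓓.Kd * ‖x - c‖ * ((gramStd G x).det * (gramStd G c).det) := by gcongr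

/-- The constant of the remainder estimate for one coordinate. [folklore] -/
def CR : ℝ :=
  (2 / 3 * (576 * (𝓓.Cu * 𝓓.Bν ^ 3 + 3 * 𝓓.Bu * 𝓓.Bν ^ 2 * 𝓓.CN)) / (gramStd G c).det +
    2 / 3 * 𝓓.Kd * (576 * (𝓓.Bu * 𝓓.Bν ^ 3)) / (gramStd G c).det ^ 2 +
    2⁻¹ * (576 * (𝓓.Bu * ((ChernZeroData.nG (G := G) (c := c) + 𝓓.K₂) * 𝓓.K₅) * 𝓓.Bν)) /
      (gramStd G c).det)

/-- `C_R ≥ 0`. [folklore] -/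
theorem CR_nonneg : 0 ≤ 𝓓.CR := by
  have := 𝓓.det_pos; have := 𝓓.Kd_nonneg; have := 𝓓.K₅_nonneg; have := 𝓓.K₂_nonneg
  have := 𝓓.Cu_nonneg; have := 𝓓.Bν_nonneg; have := 𝓓.Bu_nonneg; have := 𝓓.CN_nonneg
  have := ChernZeroData.nG_nonneg (G := G) (c := c)
  unfold CR; positivity

/-- **The remainder estimate for one coordinate**:
`|Xᵢ(x) − (−2 det L/ρ⁴)(x − c)ᵢ| ≤ C_R/r²`. [cite: Chern1945, §2, (14)-(16)] -/
theorem abs_chernCoordField_sub_le (hG : IsMetricOn G V) (hZ : ContDiffOn ℝ ∞ Z V)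
    (hx : x ∈ ball c 𝓓.δ \ {c}) (i : Fin 4) :
    |chernCoordField G Z x i - (-2 * LinearMap.det (L : (𝔼 4) →ₗ[ℝ] (𝔼 4))) /
      ‖A (L (x - c))‖ ^ 4 * (x - c) i| ≤ 𝓓.CR / ‖x - c‖ ^ 2 := by
  have hx' : x ∈ ball c 𝓓.toChernZeroData.δ \ {c} := hx
  set r := ‖x - c‖ with hr
  set ρ := ‖A (L (x - c))‖ with hρ
  have hr0 : 0 < r := ChernZeroData.norm_pos hx'
  have hr1 : r ≤ 1 := ChernZeroData.norm_le_one hx'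
  have hρ0 : 0 < ρ := ChernZeroData.rho_pos hx'
  have hc : c ∈ V := 𝓓.ball_subset (mem_ball_self 𝓓.δ_pos)
  have hd₀ := 𝓓.det_pos
  have hKd := 𝓓.Kd_nonneg; have hK₅ := 𝓓.K₅_nonneg; have hK₂ := 𝓓.K₂_nonneg
  have hCu := 𝓓.Cu_nonneg; have hBν := 𝓓.Bν_nonneg; have hBu := 𝓓.Bu_nonneg
  have hCN := 𝓓.CN_nonneg; have hnG := ChernZeroData.nG_nonneg (G := G) (c := c)
  -- the sums and their bounds
  set T₀ := chernSum₀ (lowUnit G Z x) (lowEndo G Z x) i with hT₀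
  set T₀' := chernSum₀ (modelLowUnit G c A L x) (modelLowEndo G c A L x) i with hT₀'
  set T₁ := chernSum₁ (lowUnit G Z x) (curvArray G x) (lowEndo G Z x) i with hT₁
  have h₀ : |T₀ - T₀'| ≤ 576 * (𝓓.Cu * 𝓓.Bν ^ 3 + 3 * 𝓓.Bu * 𝓓.Bν ^ 2 * 𝓓.CN) / r ^ 2 := by
    have h := abs_chernSum₀_sub_le (ChernZeroData.abs_lowUnit_le hx') (ChernZeroData.abs_modelLowUnit_le hx')
      (ChernZeroData.abs_lowUnit_sub_le hx') (ChernZeroData.abs_lowEndo_le hG hZ hx')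
      (ChernZeroData.abs_modelLowEndo_le hx') (ChernZeroData.abs_lowEndo_sub_le hG hZ hx') i
    calc _ ≤ _ := h
      _ = _ := by rw [← hr]; field_simp
  have h₀' : |T₀'| ≤ 576 * (𝓓.Bu * 𝓓.Bν ^ 3) / r ^ 3 := by
    have h := abs_chernSum₀_le (ChernZeroData.abs_modelLowUnit_le hx') (ChernZeroData.abs_modelLowEndo_le hx') i
    calc _ ≤ _ := h
      _ = _ := by rw [← hr]; field_simp
  have h₁ : |T₁| ≤ 576 * (𝓓.Bu * ((ChernZeroData.nG (G := G) (c := c) + 𝓓.K₂) * 𝓓.K₅) * 𝓓.Bν) / r := by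
    have h := abs_chernSum₁_le (ChernZeroData.abs_lowUnit_le hx')
      (ChernZeroData.abs_curvArray_le hx' (𝓓.riem_le x hx.1)) (ChernZeroData.abs_lowEndo_le hG hZ hx') i
    calc _ ≤ _ := h
      _ = _ := by rw [← hr]; field_simp
  -- the field and the model in terms of the sums
  have hX : chernCoordField G Z x i = -(((gramStd G x).det)⁻¹ * (3⁻¹ * T₀ + 4⁻¹ * T₁)) := by
    rw [chernCoordField_eq_chernVec, chernVec_apply]
  have hX₀ : (-2 * LinearMap.det (L : (𝔼 4) →ₗ[ℝ] (𝔼 4))) / ρ ^ 4 * (x - c) i =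
      -(((gramStd G c).det)⁻¹ * (3⁻¹ * T₀')) := by
    rw [hT₀', chernSum₀_modelLow (hG.symm c hc), ← hρ]
    field_simp
    ring
  rw [hX, hX₀]
  exact abs_chernVec_comb_le hr0 hr1 hd₀ hKd (by positivity) (abs_inv_det_le hx.1)
    (abs_inv_det_sub_le hx.1) h₀ h₀' h₁

end ChernZeroData₄

/-- **The remainder estimate for Chern's field at a nondegenerate zero** (the hypothesis `hR` of
`IndexFlux.abs_integral_fderiv_cutoff_sub_le_four` with `T = A ∘ L`, `κ = −2 det L`): for metric
components `G` on `V ∋ c`, positive definite, with `G_c = ⟨A·, A·⟩`, and a smooth field `Z` with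
`Z(c) = 0`, `DZ(c) = L` invertible, there are `δ > 0` and `C_R` with `B(c, δ) ⊆ V`, `G(Z, Z) ≠ 0`
and `X = chernCoordField G Z` continuous on the punctured ball, and
`‖X(x) − (−2 det L/‖AL(x − c)‖⁴)(x − c)‖ ≤ C_R/‖x − c‖²` there. [cite: Chern1945, §2, (14)-(16)] -/
theorem exists_chernCoordField_remainder_bound (hG : IsMetricOn G V)
    (hpos : ∀ x ∈ V, ∀ v : 𝔼 4, v ≠ 0 → 0 < G x v v) (hc : c ∈ V)
    (hA : ∀ v w, G c v w = ⟪A v, A w⟫) (hZ : ContDiffOn ℝ ∞ Z V) (hZc : Z c = 0)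
    (hL : fderiv ℝ Z c = L) :
    ∃ δ CR : ℝ, 0 < δ ∧ ball c δ ⊆ V ∧ (∀ x ∈ ball c δ \ {c}, G x (Z x) (Z x) ≠ 0) ∧
      ContinuousOn (chernCoordField G Z) (ball c δ \ {c}) ∧
      ∀ x ∈ ball c δ \ {c}, ‖chernCoordField G Z x -
        ((-2 * LinearMap.det (L : (𝔼 4) →ₗ[ℝ] (𝔼 4))) / ‖A (L (x - c))‖ ^ 4) • (x - c)‖ ≤
          CR / ‖x - c‖ ^ 2 := by
  obtain ⟨𝓓⟩ := exists_chernZeroData₄ hG hc hA hZ hZc hL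
  have hq : ∀ x ∈ ball c 𝓓.δ \ {c}, 0 < G x (Z x) (Z x) := fun x hx ↦
    ChernZeroData.q_pos (𝓓 := 𝓓.toChernZeroData) hx
  refine ⟨𝓓.δ, 2 * 𝓓.CR, 𝓓.δ_pos, 𝓓.ball_subset, fun x hx ↦ (hq x hx).ne', fun x hx ↦ ?_,
    fun x hx ↦ ?_⟩
  · have hxV : x ∈ V := 𝓓.ball_subset hx.1
    have hZx : Z x ≠ 0 := by
      intro h
      have := hq x hx
      rw [h] at this
      simp at this
    exact (contDiffAt_chernCoordField hG hxV (hpos x hxV) hZ hZx).continuousAt.continuousWithinAt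
  · have hcoord : ∀ i, |(chernCoordField G Z x -
        ((-2 * LinearMap.det (L : (𝔼 4) →ₗ[ℝ] (𝔼 4))) / ‖A (L (x - c))‖ ^ 4) • (x - c)) i| ≤
        𝓓.CR / ‖x - c‖ ^ 2 := fun i ↦ by
      rw [PiLp.sub_apply, PiLp.smul_apply, smul_eq_mul]
      exact ChernZeroData₄.abs_chernCoordField_sub_le hG hZ hx i
    have h := norm_le_two_mul_of_abs_apply_le (by have := 𝓓.CR_nonneg; positivity) hcoord
    calc _ ≤ _ := h
      _ = _ := by ring

end Entries

end Literature.Geometry.Riemannian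

end
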